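import Literature.MathematicalPhysics.QuantumFieldTheory.Balaban1983to89.B9SectBCodedChainRG2
import Literature.MathematicalPhysics.QuantumFieldTheory.Balaban1983to89.B9SectBStepUOfMembersR
import Literature.MathematicalPhysics.QuantumFieldTheory.Balaban1983to89.B9SectBGReg335PlaqYOfClassPb
import Literature.MathematicalPhysics.QuantumFieldTheory.Balaban1983to89.B9SectBStepL2FamilyTransferPos
import Literature.MathematicalPhysics.QuantumFieldTheory.Balaban1983to89.B9SectBL2StepRecordOn
import Literature.MathematicalPhysics.QuantumFieldTheory.Balaban1983to89.B9SectBL2GCrossY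

/-!
# Balaban [B9], Thm 3.4 p. 400, Sect. B (3.46) at `U′U` pp. 402–404, (3.35) p. 396 with p. 404 («… follow directly from the assumptions (3.35)») —
# THE ROW-13 U-LETTER STEP `SectBStepU` WITH THE L² PLAQUETTE LAW ASKED ONLY WHERE PRINT ASKS IT (GUARDED `hplaq`), AND ★★★ AT THE RECORD's READING OF
# PRINT's CLASS (`extraYPb`, `𝔸 = M_N(ℂ)`, `G ≦ U(N)`) WITH BOTH PLAQUETTE DISPLAYS `hreg335P` ∕ `hplaq` DISCHARGED
# (pub-ymgap N06, FLAG №8: director-ym №290 (1)(c) «THE (α3) OBJECT OF RECORD := this file's §4»; two displayed laws fewer, LOCATED-17∕18 cured by GUARDS)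

T. Bałaban, *Propagators for lattice gauge theories in a background field*, Commun. Math. Phys. **99** (1985) 389–434 [`Balaban1985BackgroundPropagators`, "B9"],
Thm 3.4 p. 400, Sect. B pp. 400–407, Thms 3.1–3.3 (3.42)–(3.48) pp. 397–399, (3.35)–(3.37) p. 396, (3.63)–(3.67) pp. 402–403, (3.69) p. 404, Thm 3.11 p. 416;
[4] = T. Bałaban, *Propagators and renormalization transformations for lattice gauge theories. II*, Commun. Math. Phys. **96** (1984) 223–250
[`Balaban1984PropagatorsII`], Lemma 2.1 p. 234, (2.2) p. 224, (2.45) p. 231, (2.51) p. 232, Prop. 2.6 (2.140)–(2.141) p. 247.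

statement-level skeleton of published theorems with citation tags; proofs where landed; nothing here is a claim about the Yang–Mills mass gap

WHY THIS FILE (cell context; LOCATED-17 of seat dag-n06-c, g17).  dag-n06-d's `B9SectBStepUOfMembers[R].sectBStepU_C37GY_unitary_of_members` — the object the
(α3) re-leaf of the N06 certificate consumes for row 13 — DISPLAYS the L² plaquette law UNGUARDED:
`hplaq : ∀ j α₀ U, (carrier).Reg335 c35 α₀ U → PlaqLawY (f j) (ιB j) cP U`, one `cP` for every member `j` and EVERY `α₀`.  At the record's reading of print's
class (`P := extraYPb`) every `G`-valued configuration is (3.35)-regular for SOME `α₀` (the per-cube datum `n·M·α₀` is unbounded in `α₀`), so the display asks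
`PlaqLawY … cP U` of every `G`-valued `U` of every member with ONE `cP` — impossible over a family with members of unbounded level when `G` is non-abelian
(`PlaqLawY` is the bound `‖U(∂p)Y U(∂p)⁻¹ − Y‖ ≦ cP·(L^{j})⁻²‖Y‖` at level-`j` blocks): the display is VACUOUS-AS-TYPED there (referee ref-E g27 R3 had noted
«`hplaq` is asked at every `α₀` without threshold»).  Print asks (3.35) only of the configurations of Thm 3.1's class at `α₀` with `M·α₀` small (p. 397 «0 < α₀ ≦ α₁»,
the step's own thresholds).  CURE (this file): the two places where the L² step USES `hplaq` (`B9SectBL2StepRecordOn[R].hin_KSC₃_on_explicit` and its `KSCU`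
transport) sit under binders `M ≥ Mi`, `0 < α₀`, `M·α₀ ≤ ai` whose thresholds `Mi`, `ai` the step CHOOSES — so the step goes through VERBATIM with the GUARDED law
`hplaq : ∀ j α₀ U, MInv ≤ M → 0 < α₀ → M·α₀ ≤ aInv → (carrier).Reg335 c35 α₀ U → PlaqLawY (f j) (ιB j) cP U` (the shape of the frames' `hreg335P`), choosing
`Mi := max … MInv`, `ai := min 1 aInv`.  And the guarded law IS A THEOREM at `P := extraYPb`: `plaqLawY_of_reg335PlaqY ∘ hreg335P_extraYPb` (dag-n06-c g17
`B9SectBGReg335PlaqYOfClassPb`), `cP := 2·c335Plaq ℓ aInv`.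

WHAT IS PROVED (sorry-free; standard axioms; 0 `def`; nothing of [B9] asserted — §2–§3 are the landed proofs VERBATIM with the guarded binder (new names `…_g`); §1 is VERBATIM except the announced 7-line threshold enlargement `Mi := max … MIp`, `ai := min 1 aIp` (referee ref-E g30 READ-8 d1).
* §1 `hin_KSC₃_on_explicit_g` — `B9SectBL2StepRecordOnR.hin_KSC₃_on_explicit` with the guarded `hplaq` (free thresholds `MIp aIp`, `0 < aIp`).
* §2 `hin_KSCU₃_on_pos_g`, ★ `stepL2Pos_KSCU_on_g` — `B9SectBStepsKSCUBlocksR`'s, threaded (the `StepL2Pos` member of `KSCU` asks `hplaq` only at `(MInv, aInv)`).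
* §3 ★★ `sectBStepU_of_members_g`, `thm34U_of_members_g`, ★★ `sectBStepU_C37GY_unitary_of_members_g` — dag-n06-d's assembly VERBATIM over §2 (every other member
  by name from the landed R twins: `stepGlobPos_KACU_frame_on`, `stepPos_KSCU_of_KSC`, `thm32∕33Printed_codedU`, the eight `KSCU` steps, the five `KACU` frame steps).
* §4 ★★★ **`sectBStepU_C37GY_unitary_extraYPb`** — §3's unitary theorem AT `P := extraYPb (M_N ℂ) G` with `C₀ hC₀ hreg335P` AND `cP hcP hplaq` SUPPLIED:
  `C₀ := c335Plaq ℓ aInv`, `hreg335P := hreg335P_extraYPb …`, `cP := 2·c335Plaq ℓ aInv`, `hplaq := plaqLawY_of_reg335PlaqY ∘ hreg335P_extraYPb`; ★★ `thm34U_C37GY_unitary_extraYPb`; and ★★★ `sectBStepU_C37GY_unitary_extraYPb_d261Y` ∕ `thm34U_C37GY_unitary_extraYPb_d261Y` with the Lemma-2.1 datum `(d261, h261)` DISCHARGED too (`d261Y ∕ d261Y_spec`).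
  DISPLAYED BY §4 (each print-intrinsic or structural; two fewer than §3): `hι` (sections), `hG1` (`G` contracting — true for `G ≦ U(N)`), the real basis `b M₂ hrepr hcR hcL`,
  positivity data `MInv aInv aW` with `hMd : 2(d+1) < MInv`, `hMr : r_L + 1 < MInv`, the neighbour count `mN hnbr`, `hb₁`, the G-side law `hunitA` (Δ_a(U) invertible on
  the class — Thm 3.11 at the record), the Lemma-2.1 datum `(d261, h261)` at the frames' threshold, the record's Thms 3.2 ∕ 3.3 `h32 h33`, `C38` free, `N ≥ 1`.

v1.1 — DOC-ONLY EDITION (typed by dag-n06-c g17, filed by g18 in a quiet hour; №286 (1)): lit-balaban-r06 page numerals corrected (none); header d1 of ref-E g30 READ-8 folded; A2 REGIME OF THE GUARDED `hunitA` (ref-E g30 remark): the guarded binder is inhabitable exactly when the instantiator's `(MInv, aInv)` lie in Theorem 3.11's regime («M sufficiently large, α₀ sufficiently small») — for `aInv` above print's `a₀` the half-frustrated witness of `B9Thm311ClassKeyedHunitANotInhabited` re-enters the class below `aInv` at fine members and the binder is again uninhabited; the N06 certificate chooses `aInv` from its Thm-3.11 row (filed by g18).  Every declaration byte-identical to v1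.

HONEST SCOPE.  Re-threading of landed proofs under a weaker (print-faithful) hypothesis + one instantiation; nothing of [B9] asserted; `hunitA`, `(d261,h261)`, `h32 h33`
and the numerics stay displayed; NOT a node discharge; COUNT-NEUTRAL; N06 NOT discharged; nothing continuum ∕ ℝ⁴ ∕ OS ∕ mass gap ∕ Clay.  Cell `pub-ymgap` (HUMAN
RULING D-0062), Track A node N06 [B9], seat `pub-ymgap-dag-n06-c` g17, 2026-08-29.  NEW file; nothing landed is modified.  Net new unproved facts: 0.
-/

noncomputable section

namespace Literature.MathematicalPhysics.QuantumFieldTheory.Balaban1983to89.B9SectBStepUGuardedR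

/-! ## §1 The L² input domination of the coded KSC step under the GUARDED plaquette law -/

section RecordOn

open Literature.MathematicalPhysics.QuantumFieldTheory.Balaban1983to89.B9SectBCodedClassR (RegExtraY bg9YC)

open Literature.MathematicalPhysics.QuantumFieldTheory.Balaban1983to89
open Literature.MathematicalPhysics.QuantumFieldTheory.Balaban1983to89.B6Ineq2142KLevelV1 (β)
open Literature.MathematicalPhysics.QuantumFieldTheory.Balaban1983to89.B9FromB6 (L2Block)
open Literature.MathematicalPhysics.QuantumFieldTheory.Balaban1983to89.B9Eq39Adjoint (fluct)
open Literature.MathematicalPhysics.QuantumFieldTheory.Balaban1983to89.B9SectBCodedCarrier (CCfg Coding pullK pullS)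
open Literature.MathematicalPhysics.QuantumFieldTheory.Balaban1983to89.B9Eq360DeltaPrimeAY (AfldY mulY)
open Literature.MathematicalPhysics.QuantumFieldTheory.Balaban1983to89.B9PinMembersKLevelV1 (MemberY geo9Y bg9Y)
open Literature.MathematicalPhysics.QuantumFieldTheory.Balaban1983to89.B9SectBGpLettersY (GVal)
open Literature.MathematicalPhysics.QuantumFieldTheory.Balaban1983to89.B9SectBGpFrameCodedYR (codingYx)
open Literature.MathematicalPhysics.QuantumFieldTheory.Balaban1983to89.B9SectBGpFrameCodedY (CplxLettersY)
open Literature.MathematicalPhysics.QuantumFieldTheory.Balaban1983to89.B9SectBGpReadingsYR (KSC)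
open Literature.MathematicalPhysics.QuantumFieldTheory.Balaban1983to89.B9SectBGpTransferInYR (thms_KSC_base_of_pullK)
open Literature.MathematicalPhysics.QuantumFieldTheory.Balaban1983to89.B9SectBCodedChainGlobR (KSC₂ thms_KSC₂_base_iff)
open Literature.MathematicalPhysics.QuantumFieldTheory.Balaban1983to89.B9SectBL2DictionaryYR (KSC₃)
open Literature.MathematicalPhysics.QuantumFieldTheory.Balaban1983to89.B9SectBL2SecondOrderYR (l2Block_KSC₃_base_of_record l2Block_record_at_W_of_KSC₃')
open Literature.MathematicalPhysics.QuantumFieldTheory.Balaban1983to89.B9SectBL2SecondOrderY (PlaqLawY convConst2L2 convConst2L2_nonneg cross2ConstL2 cross2ConstL2_nonneg)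
open Literature.MathematicalPhysics.QuantumFieldTheory.Balaban1983to89.B9SectBL2TransferInY (crossConstL2 crossConstL2_nonneg)
open Literature.MathematicalPhysics.QuantumFieldTheory.Balaban1983to89.B9SectBCodedChainL2R (thms_KSC₃_base_of_KSC₂ thms_mono_B₀)
open Literature.MathematicalPhysics.QuantumFieldTheory.Balaban1983to89.B9SectBCodedChainL2 (exists_thresholds_L2 l2Block_max_zero l2Block_weaken)
open Literature.MathematicalPhysics.QuantumFieldTheory.Balaban1983to89.B9SectBL2StepCodedOnR (stepL2Pos_KSC₃_on)
open Literature.MathematicalPhysics.QuantumFieldTheory.Balaban1983to89.B9SectBStepL2FamilyTransferPos (stepL2Pos_of_family_pos stepL2Pos_of_coded)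
open Literature.MathematicalPhysics.QuantumFieldTheory.Balaban1983to89.B9SectBStepWhole (StepL2Pos)
open Literature.MathematicalPhysics.QuantumFieldTheory.Balaban1983to89.B9GeoNbrCountKLevelV1 (exists_card_nbr_geo9Y_le_of_M)
open Literature.MathematicalPhysics.QuantumFieldTheory.Balaban1983to89.Node00 (SiteY BlkY IBondY CfgY SiteParY kernelFamilyS GpY)


variable {d ℓ : ℕ} {hd : 1 ≤ d + 1} {hL : Odd (ℓ + 1) ∧ 1 < ℓ + 1} {b₀ b₁ : ℝ} {Mstar : ℕ}
variable {𝔸 : Type} [NormedRing 𝔸] (P : RegExtraY d ℓ hd hL b₀ b₁ Mstar 𝔸) [NormedAlgebra ℂ 𝔸] [CompleteSpace 𝔸] [NormOneClass 𝔸] [FiniteDimensional ℝ 𝔸]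

variable {J : Type} (f : J → MemberY d ℓ hd hL b₀ b₁ Mstar) [∀ x : MemberY d ℓ hd hL b₀ b₁ Mstar, Fintype (geo9Y x).Site]
  [∀ x : MemberY d ℓ hd hL b₀ b₁ Mstar, DecidableEq (geo9Y x).Site] [∀ x : MemberY d ℓ hd hL b₀ b₁ Mstar, Nonempty (geo9Y x).Site]
  (c35 : ℝ) (G : Subgroup 𝔸ˣ) (par : ∀ j : J, SiteParY 𝔸 (f j).toKIdx) {ι : Type} [Fintype ι] [DecidableEq ι] (b : Module.Basis ι ℝ 𝔸)
  (ιB : ∀ j : J, BlkY (f j).toKIdx → IBondY (f j).toKIdx)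
  (C37 C38 : ∀ j : J, ℝ → CfgY 𝔸 (f j).toKIdx → AfldY 𝔸 (f j).toKIdx → Prop)


omit [NormOneClass 𝔸] [∀ x : MemberY d ℓ hd hL b₀ b₁ Mstar, Nonempty (geo9Y x).Site] in
/-- ★ **`hin` FOR `KSC₃` WITH POSITIVE OUTPUT CONSTANTS** (input rate `δ₀ > 0`): at every (3.35)-regular base above the thresholds, the record family's
Theorem-3.1–3.3 block (read along the decoding) with constants `(B₀, δ₀, B_β, B_ε, B_εβ, B₁, δ₁)` gives `KSC₃`'s with
`(max(c_in·max(B₀,0), 1) ∨ c_L·max(cross…)(max B₀ 0), δ₀/2, B_β, B_ε, B_εβ, B₁, δ₁)` — g7's (3.42) conversion (`thms_KSC_base_of_pullK`, neighbour count), the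
augmented (3.46) member by `l2Block_KSC₃_base_of_record` under the GUARDED plaquette law `hplaq` (asked only above `MIp` and for `M·α₀ ≤ aIp`: the step's own thresholds are enlarged to `max … MIp`, `min 1 aIp`).
[cite: Balaban1985BackgroundPropagators, Thms 3.1–3.3 (3.42)–(3.48) pp.397–399, (3.35) p.396, p.398 (first remark); Balaban1984PropagatorsII, Lemma 2.1 p.234] -/
theorem hin_KSC₃_on_explicit_g (hι : ∀ (j : J) (s : BlkY (f j).toKIdx), β (f j).toKIdx.hN (f j).toKIdx.D (f j).toKIdx.hk (ιB j s) = s)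
    (hG1 : ∀ u : 𝔸ˣ, u ∈ G → ‖(u : 𝔸)‖ ≤ 1) {M₂ : ℝ} (hM₂ : 0 ≤ M₂) (hrepr : ∀ (v : 𝔸) (j : ι), |b.repr v j| ≤ M₂ * ‖v‖) (dC : ℕ)
    (GA : ∀ j : J, B9.KernelFamily (geo9Y (f j)) (codingYx P G (f j) (C37 j) (C38 j)).bg)
    (Cinv : ∀ j : J, B9.SiteKernel (geo9Y (f j)) (codingYx P G (f j) (C37 j) (C38 j)).bg)
    (hGA : ∀ (j : J) (c : (codingYx P G (f j) (C37 j) (C38 j)).bg.Cfg),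
      (∀ lam β' ζ, 0 ≤ (GA j).h1 c lam β' ζ) ∧ (∀ lam y, 0 ≤ (GA j).e4 c lam y) ∧ (∀ lam β' ζ, 0 ≤ (GA j).h2 c lam β' ζ))
    {cP : ℝ} (hcP : 0 ≤ cP)
    {MIp aIp : ℝ} (haIp : 0 < aIp)
    (hplaq : ∀ (j : J) (α₀ : ℝ) (U : CfgY 𝔸 (f j).toKIdx), MIp ≤ (geo9Y (f j)).M → 0 < α₀ → (geo9Y (f j)).M * α₀ ≤ aIp →
      (bg9YC 𝔸 G P (f j)).Reg335 c35 α₀ U → PlaqLawY (f j) (ιB j) cP U) :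
    ∀ (B₀ δ₀ : ℝ) (Bβ Bε : ℝ → ℝ) (Bεβ : ℝ → ℝ → ℝ) (B₁ δ₁ : ℝ), 0 < B₀ → 0 < δ₀ → 0 < B₁ → 0 < δ₁ →
      ∃ (Mi ai B₀' δ₀' : ℝ) (Bβ' Bε' : ℝ → ℝ) (Bεβ' : ℝ → ℝ → ℝ) (B₁' δ₁' : ℝ), 0 < ai ∧ 0 < B₀' ∧ 0 < δ₀' ∧ 0 < B₁' ∧ 0 < δ₁' ∧
        ∀ j : J, Mi ≤ (geo9Y (f j)).M → ∀ α₀ : ℝ, 0 < α₀ → (geo9Y (f j)).M * α₀ ≤ ai →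
          ∀ c : (codingYx P G (f j) (C37 j) (C38 j)).bg.Cfg, (codingYx P G (f j) (C37 j) (C38 j)).bg.Reg335 c35 α₀ c →
          B9.Thms31to33IneqAt dC (pullK (codingYx P G (f j) (C37 j) (C38 j))
              (kernelFamilyS (f j).toKIdx (bg9YC 𝔸 G P (f j)) (fun U => U) (GpY (f j).toKIdx (par j)) (par j))) (GA j) (Cinv j) B₀ δ₀ Bβ Bε Bεβ B₁ δ₁ c →
          B9.Thms31to33IneqAt dC (KSC₃ P G (f j) (par j) (C37 j) (C38 j)) (GA j) (Cinv j) B₀' δ₀' Bβ' Bε' Bεβ' B₁' δ₁' c := by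
  intro B₀ δ₀ Bβ Bε Bεβ B₁ δ₁ hB₀ hδ₀ hB₁ hδ₁
  obtain ⟨ML, mN, hcnt⟩ := exists_card_nbr_geo9Y_le_of_M (d := d) (ℓ := ℓ) (hd := hd) (hL := hL) (b₀ := b₀) (b₁ := b₁) (2 * ((d : ℝ) + 1))
  obtain ⟨d261, Mthr, hthr⟩ := exists_thresholds_L2 f
  set cIn : ℝ := ((ℓ + 1 : ℕ) : ℝ) * Real.exp (|δ₀| * (2 * ((d : ℝ) + 1))) + ((mN : ℝ) * (M₂ * ∑ j, ‖b j‖) * Real.exp (|δ₀| * (2 * ((d : ℝ) + 1))) + 1)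
    with hcIn
  set Sb : ℝ := ∑ j, ‖b j‖ with hSb
  set sι : ℝ := Real.sqrt (Fintype.card ι) with hsι
  set Λ : ℝ := ((ℓ : ℝ) + 1) ^ 4 with hΛ
  set BL : ℝ := (sι * M₂ * Sb) * max (crossConstL2 M₂ Sb sι d (d261 δ₀) δ₀ Λ (max B₀ 0)) (cross2ConstL2 cP M₂ Sb sι d (d261 δ₀) δ₀ Λ (max B₀ 0))
    with hBL
  have hΛ1 : 1 ≤ Λ := one_le_pow₀ (by linarith [(Nat.cast_nonneg ℓ : (0 : ℝ) ≤ ℓ)])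
  have hSb0 : 0 ≤ Sb := Finset.sum_nonneg fun j _ => norm_nonneg _
  have hsι0 : 0 ≤ sι := Real.sqrt_nonneg _
  have hBL0 : 0 ≤ BL := by
    have := crossConstL2_nonneg hM₂ hSb0 hsι0 d (d261 δ₀) δ₀ Λ (le_max_right B₀ 0)
    rw [hBL]; exact mul_nonneg (by positivity) (le_max_of_le_left this)
  refine ⟨max (max (max ML (2 * ((d : ℝ) + 1) + 1)) (Mthr δ₀)) MIp, min 1 aIp, max (max (cIn * max B₀ 0) 1) BL, min δ₀ (δ₀ / 2), Bβ, Bε, Bεβ, B₁, δ₁,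
    lt_min one_pos haIp, lt_max_of_lt_left (lt_max_of_lt_right one_pos), lt_min hδ₀ (half_pos hδ₀), hB₁, hδ₁, fun j hM' α₀ hα₀ hMa' c hreg hT => ?_⟩
  have hM : max (max ML (2 * ((d : ℝ) + 1) + 1)) (Mthr δ₀) ≤ (geo9Y (f j)).M := le_trans (le_max_left _ _) hM'
  have hMI : MIp ≤ (geo9Y (f j)).M := le_trans (le_max_right _ _) hM'
  have hMaI : (geo9Y (f j)).M * α₀ ≤ aIp := hMa'.trans (min_le_right _ _)
  obtain ⟨U, rfl, hU335⟩ := (codingYx P G (f j) (C37 j) (C38 j)).exists_of_bg_Reg335 hreg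
  have hU : GVal G (f j).toKIdx U := hU335.1.1
  have hM2 : 2 * ((d : ℝ) + 1) < (geo9Y (f j)).M := by
    have := le_trans (le_max_right _ _) (le_trans (le_max_left _ _) hM); linarith
  have hML : ML ≤ (geo9Y (f j)).M := le_trans (le_max_left _ _) (le_trans (le_max_left _ _) hM)
  have hMt : Mthr δ₀ ≤ (geo9Y (f j)).M := le_trans (le_max_right _ _) hM
  obtain ⟨h261, hT1, -, -, hTi2⟩ := hthr j δ₀ hδ₀ hMt
  -- the (3.42)–(3.45), (3.47) members: g7's conversion at the base (`KSC`), = `KSC₂`'s at a base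
  have hK : B9.Thms31to33IneqAt dC (KSC P G (f j) (par j) (C37 j) (C38 j)) (GA j) (Cinv j) (cIn * max B₀ 0) δ₀ Bβ Bε Bεβ B₁ δ₁ (.base U) :=
    thms_KSC_base_of_pullK P G (f j) (par j) b (ιB j) (C37 j) (C38 j) (hι j) hG1 hU hM₂ hrepr hM2 (fun a => hcnt Mstar (f j) hML a) dC (GA j) (Cinv j) hT
  have hK2 : B9.Thms31to33IneqAt dC (KSC₂ P G (f j) (par j) (C37 j) (C38 j)) (GA j) (Cinv j) (max (cIn * max B₀ 0) 1) δ₀ Bβ Bε Bεβ B₁ δ₁ (.base U) :=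
    thms_mono_B₀ P G (f j) (C37 j) (C38 j) dC _ (GA j) (Cinv j) (le_max_left _ _)
      ((thms_KSC₂_base_iff P G (f j) (par j) (C37 j) (C38 j) dC (GA j) (Cinv j) _ δ₀ Bβ Bε Bεβ B₁ δ₁ U).2 hK)
  -- the augmented (3.46) member from the record's block at `U`
  have hL2 : L2Block (kernelFamilyS (f j).toKIdx (bg9YC 𝔸 G P (f j)) (fun U => U) (GpY (f j).toKIdx (par j)) (par j)) (max B₀ 0) δ₀ U :=
    l2Block_max_zero (f j) _ fun n lam hh y y' hc hs => hT.1.1.2.1 n lam hh y y' hc hs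
  have hK3 := l2Block_KSC₃_base_of_record P G (f j) (par j) b (ιB j) (C37 j) (C38 j) (hι j) hG1 hM₂ hrepr hδ₀ h261 hΛ1 hT1 hTi2 hcP (le_max_right B₀ 0)
    hU (hplaq j α₀ U hMI hα₀ hMaI hU335) hL2
  have h := thms_KSC₃_base_of_KSC₂ P G (f j) (par j) (C37 j) (C38 j) dC (GA j) (Cinv j) (le_trans zero_le_one (le_max_right _ _)) (hGA j _).1 (hGA j _).2.1
    (hGA j _).2.2 hK2 hBL0 (by rw [hBL, hSb, hsι]; exact hK3)
  exact h

end RecordOn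

/-! ## §2 The `StepL2Pos` member of `KSCU` under the GUARDED plaquette law -/

section Blocks

open Literature.MathematicalPhysics.QuantumFieldTheory.Balaban1983to89.B9SectBCodedClassR (RegExtraY bg9YC)
open Literature.MathematicalPhysics.QuantumFieldTheory.Balaban1983to89.B9SectBStepsKSCUBlocksR (KACU_holder_nonneg houtL2_KSCU_on)

open Literature.MathematicalPhysics.QuantumFieldTheory.Balaban1983to89
open Literature.MathematicalPhysics.QuantumFieldTheory.Balaban1983to89.B6KLevelCensusIndexV1 (KIdx kGeo)
open Literature.MathematicalPhysics.QuantumFieldTheory.Balaban1983to89.B6Ineq2142KLevelV1 (β)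
open Literature.MathematicalPhysics.QuantumFieldTheory.Balaban1983to89.B9FromB6 (EBlock L2Block GlobBlock)
open Literature.MathematicalPhysics.QuantumFieldTheory.Balaban1983to89.B9SectBCodedCarrier (CCfg Coding pullK pullS)
open Literature.MathematicalPhysics.QuantumFieldTheory.Balaban1983to89.B9Eq360DeltaPrimeAY (AfldY)
open Literature.MathematicalPhysics.QuantumFieldTheory.Balaban1983to89.B9PinMembersKLevelV1 (MemberY geo9Y bg9Y)
open Literature.MathematicalPhysics.QuantumFieldTheory.Balaban1983to89.B9SectBGpLettersY (GVal decY)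
open Literature.MathematicalPhysics.QuantumFieldTheory.Balaban1983to89.B9SectBGpFrameCodedYR (codingYx)
open Literature.MathematicalPhysics.QuantumFieldTheory.Balaban1983to89.B9SectBGpFrameCodedY (CplxLettersY)
open Literature.MathematicalPhysics.QuantumFieldTheory.Balaban1983to89.B9SectBGpReadingsYR (KSC)
open Literature.MathematicalPhysics.QuantumFieldTheory.Balaban1983to89.B9SectBGpReadingsY (baseY etaS_eq_eta)
open Literature.MathematicalPhysics.QuantumFieldTheory.Balaban1983to89.B9SectBGpReadingsYProdR (hasMajorant_letters_cc_of_eBlock)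
open Literature.MathematicalPhysics.QuantumFieldTheory.Balaban1983to89.B9Ineq347SiteReadingY (globBlock_kernelFamilyS_of_eBlock)
open Literature.MathematicalPhysics.QuantumFieldTheory.Balaban1983to89.B9SectBCodedReadingsUR (KSCU KACU)
open Literature.MathematicalPhysics.QuantumFieldTheory.Balaban1983to89.B9SectBStepsKSCUR (KACU_members_base ineq342_346_347_congr thms_KSCU_base_iff hin_KSCU_on_pos)
open Literature.MathematicalPhysics.QuantumFieldTheory.Balaban1983to89.B9SectBGpTransferInYR (ineq343_345_congr)
open Literature.MathematicalPhysics.QuantumFieldTheory.Balaban1983to89.B9SectBEGlobAnStepRecordOnR (stepEPos_KSC_on)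
open Literature.MathematicalPhysics.QuantumFieldTheory.Balaban1983to89.B9SectBL2DictionaryYR (KSC₃)
open Literature.MathematicalPhysics.QuantumFieldTheory.Balaban1983to89.B9SectBL2DictionaryY (l2AugS)
open Literature.MathematicalPhysics.QuantumFieldTheory.Balaban1983to89.B9SectBL2TransferConvY (swap34 pref6_swap34 kernelFamilyS_l2_le_l2AugS)
open Literature.MathematicalPhysics.QuantumFieldTheory.Balaban1983to89.B9SectBL2SecondOrderY (PlaqLawY)
open Literature.MathematicalPhysics.QuantumFieldTheory.Balaban1983to89.B9SectBL2StepCodedOnR (stepL2Pos_KSC₃_on)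
open Literature.MathematicalPhysics.QuantumFieldTheory.Balaban1983to89.B9SectBStepL2FamilyTransferPos (stepL2Pos_of_family_pos)
open Literature.MathematicalPhysics.QuantumFieldTheory.Balaban1983to89.B9SectBStepPosFamilyTransfer (stepEPos_of_family_pos stepPos_blk_of_family_pos)
open Literature.MathematicalPhysics.QuantumFieldTheory.Balaban1983to89.B9SectBStepWhole (StepEPos StepGlobPos StepL2Pos)
open Literature.MathematicalPhysics.QuantumFieldTheory.Balaban1983to89.B9GeoNormsKLevelV1 (geo9K_wNorm_nonneg)
open Literature.MathematicalPhysics.QuantumFieldTheory.Balaban1983to89.Node00 (SiteY BlkY IBondY CfgY SiteParY BondParY BondOpY deltaPrimeAY kernelFamilyS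
  kernelFamilyB GpY UboxY)
open Literature.MathematicalPhysics.QuantumFieldTheory.Balaban1983to89.Node00.OpsYRead342 (eBlock_kernelFamilyS_of_hasMajorant)
open Literature.MathematicalPhysics.QuantumFieldTheory.Balaban1983to89.Node00.OpsYHolderFar (holderQB_nonneg)


variable {d ℓ : ℕ} {hd : 1 ≤ d + 1} {hL : Odd (ℓ + 1) ∧ 1 < ℓ + 1} {b₀ b₁ : ℝ} {Mstar : ℕ}
variable {𝔸 : Type} [NormedRing 𝔸] (P : RegExtraY d ℓ hd hL b₀ b₁ Mstar 𝔸) [NormedAlgebra ℂ 𝔸] [CompleteSpace 𝔸] [FiniteDimensional ℝ 𝔸]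


variable {J : Type} (f : J → MemberY d ℓ hd hL b₀ b₁ Mstar) [∀ x : MemberY d ℓ hd hL b₀ b₁ Mstar, Fintype (geo9Y x).Site]
  (c35 : ℝ) (G : Subgroup 𝔸ˣ) (par : ∀ j : J, SiteParY 𝔸 (f j).toKIdx) (OA : ∀ j : J, BondOpY 𝔸 (f j).toKIdx)
  (parB : ∀ j : J, BondParY 𝔸 (f j).toKIdx) {ι : Type} [Fintype ι] (b : Module.Basis ι ℝ 𝔸)
  (ιB : ∀ j : J, BlkY (f j).toKIdx → IBondY (f j).toKIdx)
  (C37 C38 : ∀ j : J, ℝ → CfgY 𝔸 (f j).toKIdx → AfldY 𝔸 (f j).toKIdx → Prop)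
  (Cinv : ∀ j : J, B9.SiteKernel (geo9Y (f j)) (bg9YC 𝔸 G P (f j)))

/-- ★ **`hin` FOR THE `L²` STEP WITH POSITIVE OUTPUT CONSTANTS** (input families `(KSCU, KACU, pullS C⁻¹)`; output `KSC₃` with the shared `KACU`, `pullS C⁻¹`):
at a (3.35)-regular base the block is the record's read along the decoding (`thms_KSCU_base_iff`), then §1's `hin_KSC₃_on_explicit_g` (the
augmented (3.46) member under the GUARDED plaquette law of the regular base); `KACU`'s Hölder members are nonnegative (§1).
[cite: Balaban1985BackgroundPropagators, Thms 3.1–3.3 (3.42)–(3.48) pp.397–399, (3.35) p.396, p.398 (first remark), p.404 (after (3.69)); Balaban1984PropagatorsII, Lemma 2.1 p.234] -/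
theorem hin_KSCU₃_on_pos_g [∀ x : MemberY d ℓ hd hL b₀ b₁ Mstar, DecidableEq (geo9Y x).Site] [DecidableEq ι]
    (hι : ∀ (j : J) (s : BlkY (f j).toKIdx), β (f j).toKIdx.hN (f j).toKIdx.D (f j).toKIdx.hk (ιB j s) = s)
    (hG1 : ∀ u : 𝔸ˣ, u ∈ G → ‖(u : 𝔸)‖ ≤ 1) {M₂ : ℝ} (hM₂ : 0 ≤ M₂) (hrepr : ∀ (v : 𝔸) (j : ι), |b.repr v j| ≤ M₂ * ‖v‖) (dC : ℕ)
    {cP : ℝ} (hcP : 0 ≤ cP)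
    {MIp aIp : ℝ} (haIp : 0 < aIp)
    (hplaq : ∀ (j : J) (α₀ : ℝ) (U : CfgY 𝔸 (f j).toKIdx), MIp ≤ (geo9Y (f j)).M → 0 < α₀ → (geo9Y (f j)).M * α₀ ≤ aIp →
      (bg9YC 𝔸 G P (f j)).Reg335 c35 α₀ U → PlaqLawY (f j) (ιB j) cP U) :
    ∀ (B₀ δ₀ : ℝ) (Bβ Bε : ℝ → ℝ) (Bεβ : ℝ → ℝ → ℝ) (B₁ δ₁ : ℝ), 0 < B₀ → 0 < δ₀ → 0 < B₁ → 0 < δ₁ →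
      ∃ (Mi ai B₀' δ₀' : ℝ) (Bβ' Bε' : ℝ → ℝ) (Bεβ' : ℝ → ℝ → ℝ) (B₁' δ₁' : ℝ), 0 < ai ∧ 0 < B₀' ∧ 0 < δ₀' ∧ 0 < B₁' ∧ 0 < δ₁' ∧
        ∀ j : J, Mi ≤ (geo9Y (f j)).M → ∀ α₀ : ℝ, 0 < α₀ → (geo9Y (f j)).M * α₀ ≤ ai →
          ∀ c : (codingYx P G (f j) (C37 j) (C38 j)).bg.Cfg, (codingYx P G (f j) (C37 j) (C38 j)).bg.Reg335 c35 α₀ c →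
          B9.Thms31to33IneqAt dC (KSCU P G (f j) (par j) (C37 j) (C38 j)) (KACU P G (f j) (OA j) (parB j) (C37 j) (C38 j))
              (pullS (codingYx P G (f j) (C37 j) (C38 j)) (Cinv j)) B₀ δ₀ Bβ Bε Bεβ B₁ δ₁ c →
          B9.Thms31to33IneqAt dC (KSC₃ P G (f j) (par j) (C37 j) (C38 j)) (KACU P G (f j) (OA j) (parB j) (C37 j) (C38 j))
              (pullS (codingYx P G (f j) (C37 j) (C38 j)) (Cinv j)) B₀' δ₀' Bβ' Bε' Bεβ' B₁' δ₁' c := by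
  intro B₀ δ₀ Bβ Bε Bεβ B₁ δ₁ hB₀ hδ₀ hB₁ hδ₁
  obtain ⟨Mi, ai, B₀', δ₀', Bβ', Bε', Bεβ', B₁', δ₁', hai, hB₀', hδ₀', hB₁', hδ₁', H⟩ :=
    hin_KSC₃_on_explicit_g P f c35 G par b ιB C37 C38 hι hG1 hM₂ hrepr dC (fun j => KACU P G (f j) (OA j) (parB j) (C37 j) (C38 j))
      (fun j => pullS (codingYx P G (f j) (C37 j) (C38 j)) (Cinv j)) (fun j c => KACU_holder_nonneg P G (f j) (OA j) (parB j) (C37 j) (C38 j) c)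
      hcP haIp hplaq B₀ δ₀ Bβ Bε Bεβ B₁ δ₁ hB₀ hδ₀ hB₁ hδ₁
  refine ⟨Mi, ai, B₀', δ₀', Bβ', Bε', Bεβ', B₁', δ₁', hai, hB₀', hδ₀', hB₁', hδ₁', fun j hM α₀ hα₀ hMa c hreg hT => ?_⟩
  obtain ⟨U, rfl, -⟩ := (codingYx P G (f j) (C37 j) (C38 j)).exists_of_bg_Reg335 hreg
  refine H j hM α₀ hα₀ hMa _ hreg ?_
  obtain ⟨⟨h42, h43⟩, hC, ⟨g42, g43⟩⟩ := (thms_KSCU_base_iff P G (f j) (par j) (OA j) (parB j) (C37 j) (C38 j) dC (Cinv j) B₀ δ₀ Bβ Bε Bεβ B₁ δ₁ U).1 hT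
  obtain ⟨ae, ah1, ae4, ah2, al2, ag⟩ := KACU_members_base P G (f j) (OA j) (parB j) (C37 j) (C38 j) U
  exact ⟨⟨h42, h43⟩, hC, ⟨ineq342_346_347_congr P G (f j) (C37 j) (C38 j) _ _ (fun n => (ae n).symm) (fun n => (al2 n).symm)
    (fun n => (ag n).symm) B₀ δ₀ g42, ineq343_345_congr P G (f j) (C37 j) (C38 j) _ _ ah1.symm ae4.symm ah2.symm Bβ Bε Bεβ δ₀ g43⟩⟩

/-- ★★ **`StepL2Pos` OF `KSCU` over the coded carrier** (all six (3.46) members; input families `(KSCU, KACU, pullS C⁻¹)`): the coded step `stepL2Pos_KSC₃_on`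
(gen 9, with `GA := KACU`, `Cinv := pullS C⁻¹`) transported by `stepL2Pos_of_family_pos` — `hin_KSCU₃_on_pos_g`, `houtL2_KSCU_on`.  Displayed: the root
frame's structural data and the GUARDED plaquette law `hplaq` of the regular base (asked only at `M ≥ MInv`, `0 < α₀`, `M·α₀ ≤ aInv` — the frame's own thresholds).
[cite: Balaban1985BackgroundPropagators, Thm 3.1 (3.46) p.398, Thm 3.4 p.400, (3.63)–(3.67) pp.402–403, p.403 l.1–9, p.404 (after (3.69)); Balaban1984PropagatorsII, Prop. 2.6 (2.140)–(2.141) p.247, Lemma 2.1 p.234] -/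
theorem stepL2Pos_KSCU_on_g [∀ x : MemberY d ℓ hd hL b₀ b₁ Mstar, DecidableEq (geo9Y x).Site] [∀ x : MemberY d ℓ hd hL b₀ b₁ Mstar, Nonempty (geo9Y x).Site]
    [NormOneClass 𝔸] [DecidableEq ι]
    (hι : ∀ (j : J) (s : BlkY (f j).toKIdx), β (f j).toKIdx.hN (f j).toKIdx.D (f j).toKIdx.hk (ιB j s) = s)
    (hG1 : ∀ u : 𝔸ˣ, u ∈ G → ‖(u : 𝔸)‖ ≤ 1) (hpar : ∀ j (U : CfgY 𝔸 (f j).toKIdx), GVal G (f j).toKIdx U → ∀ z w, par j U z w ∈ G)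
    (hunit : ∀ j (U : CfgY 𝔸 (f j).toKIdx), GVal G (f j).toKIdx U → IsUnit (deltaPrimeAY (f j).toKIdx (par j) U))
    (dB : ℕ) (M₂ : ℝ) (hM₂ : 0 ≤ M₂) (hrepr : ∀ (v : 𝔸) (j : ι), |b.repr v j| ≤ M₂ * ‖v‖) (hcR : 0 < M₂ * ∑ j, ‖b j‖)
    (hcL : 0 < Real.sqrt (Fintype.card ι) * M₂ * ∑ j, ‖b j‖)
    (Cq : ℝ) (hCq : 0 ≤ Cq) (hC37 : ∀ j β' U a, C37 j β' U a → GVal G (f j).toKIdx U ∧ CplxLettersY G (f j) (par j) (ιB j) Cq β' U a)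
    (MInv aInv aW : ℝ) (hMInv : 0 < MInv) (haInv : 0 < aInv) (haW : 0 < aW) {cP : ℝ} (hcP : 0 ≤ cP)
    (hplaq : ∀ (j : J) (α₀ : ℝ) (U : CfgY 𝔸 (f j).toKIdx), MInv ≤ (geo9Y (f j)).M → 0 < α₀ → (geo9Y (f j)).M * α₀ ≤ aInv →
      (bg9YC 𝔸 G P (f j)).Reg335 c35 α₀ U → PlaqLawY (f j) (ιB j) cP U) :
    StepL2Pos dB c35 (fun j => geo9Y (f j)) (fun j => (codingYx P G (f j) (C37 j) (C38 j)).bg)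
      (fun j => KSCU P G (f j) (par j) (C37 j) (C38 j)) (fun j => KACU P G (f j) (OA j) (parB j) (C37 j) (C38 j))
      (fun j => pullS (codingYx P G (f j) (C37 j) (C38 j)) (Cinv j)) (fun j => KSCU P G (f j) (par j) (C37 j) (C38 j)) :=
  stepL2Pos_of_family_pos dB c35 (fun j => geo9Y (f j)) (fun j => (codingYx P G (f j) (C37 j) (C38 j)).bg)
    (fun j => KSC₃ P G (f j) (par j) (C37 j) (C38 j)) (fun j => KSCU P G (f j) (par j) (C37 j) (C38 j))
    (fun j => KACU P G (f j) (OA j) (parB j) (C37 j) (C38 j)) (fun j => KACU P G (f j) (OA j) (parB j) (C37 j) (C38 j))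
    (fun j => KSC₃ P G (f j) (par j) (C37 j) (C38 j)) (fun j => KSCU P G (f j) (par j) (C37 j) (C38 j))
    (fun j => pullS (codingYx P G (f j) (C37 j) (C38 j)) (Cinv j))
    (hin_KSCU₃_on_pos_g P f c35 G par OA parB b ιB C37 C38 Cinv hι hG1 hM₂ hrepr dB hcP haInv hplaq)
    (houtL2_KSCU_on P f c35 G par C37 C38)
    (stepL2Pos_KSC₃_on P f c35 G b C37 C38 par ιB hι hG1 hpar hunit dB M₂ hM₂ hrepr hcR hcL Cq hCq hC37 MInv aInv aW hMInv haInv haW _ _)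

end Blocks

/-! ## §3 `SectBStepU` ∕ `Thm34U` assembled with the GUARDED plaquette law (dag-n06-d's assembly, verbatim over §2) -/

section Members

open Literature.MathematicalPhysics.QuantumFieldTheory.Balaban1983to89.B9SectBCodedClassR (RegExtraY bg9YC)
open Literature.MathematicalPhysics.QuantumFieldTheory.Balaban1983to89.B9SectBStepUOfMembersR (stepPos_KSCU_of_KSC thm32Printed_codedU thm33Printed_codedU)

open B6Ineq2142KLevelV1 (β)
open B6RandomWalk (Ineq261)
open B9Thm34Ext (toB6)
open B9FromB6 (EBlock GlobBlock)
open B9PinMembersKLevelV1 (MemberY geo9Y bg9Y)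
open B9Eq360DeltaPrimeAY (AfldY)
open B9SectBGpLettersY (GVal)
open B9SectBGpFrameCodedYR (codingYx)
open B9SectBGpFrameCodedY (CplxLettersY)
open B9SectBGpReadingsYR (KSC)
open B9SectBCodedCarrier (CCfg pullK pullS thm32Printed_coded thm33Printed_coded)
open B9SectBCodedReadingsUR (KSCU KACU SectBStepU Thm34U)
open B9SectBCodedChainAnR (IsAnKY)
open B9SectBKerFrameCodedYR (CinvY)
open B9SectBStepWhole (StepPos StepEPos StepGlobPos StepL2Pos StepH1Pos StepE4Pos StepH2Pos StepKerPos StepAnalyticPos sectBStepPrinted_of_posBlockSteps)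
open B9SectBStepPosFamilyTransfer (stepPos_of_family_pos stepPos_blk_of_family_pos)
open B9RWSumsReadsNbr (nbr)
open B9SectBGClassLettersY (Reg335PlaqY CplxLettersGY VarParBY)
open B9SectBGFrameCodedYRG (gFrame₅CodedOn stepEPos_KACU_frame_on)
open B9SectBGStepCodedFGlobR (globBlock_KACU_prod_of_eBlock globBlock_mono_const)
open B9SectBH1GFrameCodedYRG (h1GFrame₆CodedOn)
open B9Eq340HolderLipParBYR (hLipB_parBY)
open B9Eq340HolderLipParBYRG (stepH1Pos_KACU_frame_parBY_on)
open B9Eq340HolderLipParBY (hparB_parBY)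
open B9Eq340TaxiContourLocalityY (rLB rLB_nonneg)
open B9SectBE4H2GFrameCodedYRG (e4h2GFrame₆CodedOn stepE4Pos_KACU_frame_on stepH2Pos_KACU_frame_on)
open B9SectBL2GFrameCodedY (Read377L2)
open B9SectBL2SecondOrderY (PlaqLawY)
open B9SectBL2GFrameCodedV8YRG (stepL2Pos_KACU_frame₈_on)
open B9SectBL2GRead377YRG (read377L2_gFrame₅CodedOn)
open B9SectBCodedClassGY (C37GY hC37_of_C37GY hC37G_of_C37GY hvarB_of_C37GY)
open B9Eq359VarParBY (cVarGY cVarGY_nonneg)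
open B9SectBStepsKSCUR (hin_KSCU_on_pos stepAnalyticPos_KSCU_on KSCU_members_base KACU_members_base ineq342_346_347_congr)
open B9SectBGpTransferInYR (ineq343_345_congr)
open B9SectBStepsKSCUBlocksR (stepEPos_KSCU_on stepGlobPos_KSCU_on)
open B9Eq340HolderLipParSymYR (stepH1Pos_KSCU_parSymY_on)
open B9SectBE4FrameCodedYR (stepE4Pos_KSCU_on)
open B9SectBH2FrameCodedYR (stepH2Pos_KSCU_on)
open B9SectBKerStepParSymYR (stepKerPos_KSCU_parSymY_on)
open B9GeoNormsKLevelModelSignsV1 (modelSignsOn_geo9K)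
open Node00 (SiteY BlkY FBondY IBondY CfgY SiteParY BondParY BondOpY GAY GpY XY deltaAY deltaPrimeAY parSymY parBY parSymY_inv_symm kernelFamilyS kernelFamilyB)

variable {d ℓ : ℕ} {hd : 1 ≤ d + 1} {hL : Odd (ℓ + 1) ∧ 1 < ℓ + 1} {b₀ b₁ : ℝ} {Mstar : ℕ}

section General

variable {𝔸 : Type} [NormedRing 𝔸] (P : RegExtraY d ℓ hd hL b₀ b₁ Mstar 𝔸) [NormedAlgebra ℂ 𝔸] [CompleteSpace 𝔸] [NormOneClass 𝔸] [FiniteDimensional ℝ 𝔸]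
  {J : Type} (f : J → MemberY d ℓ hd hL b₀ b₁ Mstar) [∀ x : MemberY d ℓ hd hL b₀ b₁ Mstar, Fintype (geo9Y x).Site]
  [instDS : ∀ x : MemberY d ℓ hd hL b₀ b₁ Mstar, DecidableEq (geo9Y x).Site] [instNE : ∀ x : MemberY d ℓ hd hL b₀ b₁ Mstar, Nonempty (geo9Y x).Site]
  (c35 : ℝ) (G : Subgroup 𝔸ˣ) {ι : Type} [Fintype ι] [DecidableEq ι] (b : Module.Basis ι ℝ 𝔸)
  (ιB : ∀ j : J, BlkY (f j).toKIdx → IBondY (f j).toKIdx)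
  (C38 : ∀ j : J, ℝ → CfgY 𝔸 (f j).toKIdx → AfldY 𝔸 (f j).toKIdx → Prop)

/-! ## §1 ★ The frame-route (3.47) step of the bond family `KACU` (no (3.85) display) -/

section Glob

variable (par : ∀ j : J, SiteParY 𝔸 (f j).toKIdx) (parB : ∀ j : J, BondParY 𝔸 (f j).toKIdx)
  (C37 : ∀ j : J, ℝ → CfgY 𝔸 (f j).toKIdx → AfldY 𝔸 (f j).toKIdx → Prop)

/-- ★ **`StepGlobPos` OF THE CODED BOND FAMILY `KACU` THROUGH THE G FRAME**: the frame's (3.42) step `stepEPos_KACU_frame_on` followed, at every coded product,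
by dag-n06-c's «(3.42) block ⟹ (3.47) block» (`globBlock_KACU_prod_of_eBlock`, [4] Lemma 2.1) — the proof of Route F's `stepGlobPos_KACU_of_385` with the
frame's (3.42) step in place of the displayed (3.85); displayed: exactly the binders of `stepEPos_KACU_frame_on`.
[cite: Balaban1985BackgroundPropagators, Thm 3.4 p.400, (3.47) p.398 («consequences of the local ones (3.42) and Lemma 2.1»), (3.82)–(3.86) p.407; Balaban1984PropagatorsII, Lemma 2.1 p.234, (2.51) p.232] -/
theorem stepGlobPos_KACU_frame_on (hι : ∀ (j : J) (s : BlkY (f j).toKIdx), β (f j).toKIdx.hN (f j).toKIdx.D (f j).toKIdx.hk (ιB j s) = s)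
    (hG1 : ∀ u : 𝔸ˣ, u ∈ G → ‖(u : 𝔸)‖ ≤ 1) (hpar : ∀ j (U : CfgY 𝔸 (f j).toKIdx), GVal G (f j).toKIdx U → ∀ z w, par j U z w ∈ G)
    (hunit : ∀ j (U : CfgY 𝔸 (f j).toKIdx), GVal G (f j).toKIdx U → IsUnit (deltaPrimeAY (f j).toKIdx (par j) U))
    (M₂ : ℝ) (hM₂ : 0 ≤ M₂) (hrepr : ∀ (v : 𝔸) (j : ι), |b.repr v j| ≤ M₂ * ‖v‖) (hcR : 0 < M₂ * ∑ j, ‖b j‖)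
    (Cq : ℝ) (hCq : 0 ≤ Cq) (hC37 : ∀ j β' U a, C37 j β' U a → GVal G (f j).toKIdx U ∧ CplxLettersY G (f j) (par j) (ιB j) Cq β' U a)
    (MInv aInv aW : ℝ) (hMInv : 0 < MInv) (haInv : 0 < aInv) (haW : 0 < aW)
    (hunitX : ∀ j (U : CfgY 𝔸 (f j).toKIdx), GVal G (f j).toKIdx U → IsUnit (XY (f j).toKIdx (par j) (GpY (f j).toKIdx (par j)) U))
    (hsym : ∀ j (U : CfgY 𝔸 (f j).toKIdx) (z w : SiteY (f j).toKIdx), par j U z w = (par j U w z)⁻¹)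
    (hunitA : ∀ j (α₀ : ℝ) (U : CfgY 𝔸 (f j).toKIdx), MInv ≤ (geo9Y (f j)).M → 0 < α₀ → (geo9Y (f j)).M * α₀ ≤ aInv →
      (bg9YC 𝔸 G P (f j)).Reg335 c35 α₀ U → IsUnit (deltaAY (f j).toKIdx (par j) (parB j) (GpY (f j).toKIdx (par j)) U))
    (hparB : ∀ j (U : CfgY 𝔸 (f j).toKIdx), GVal G (f j).toKIdx U → ∀ y f', parB j U y f' ∈ G) (hb₁ : 0 ≤ b₁)
    (C₀ : ℝ) (hC₀ : 0 ≤ C₀)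
    (hreg335P : ∀ j (α₀ : ℝ) (U : CfgY 𝔸 (f j).toKIdx), MInv ≤ (geo9Y (f j)).M → 0 < α₀ → (geo9Y (f j)).M * α₀ ≤ aInv →
      (bg9YC 𝔸 G P (f j)).Reg335 c35 α₀ U → Reg335PlaqY G (f j) (ιB j) C₀ U)
    (hC37G : ∀ j β' U a, C37 j β' U a → CplxLettersGY G (f j) (ιB j) β' U a)
    (cVar : ℝ) (hcVar : 0 ≤ cVar) (hvarB : ∀ j β' U a, C37 j β' U a → VarParBY (f j).toKIdx (parB j) cVar β' U a)
    (hMd : 2 * ((d : ℝ) + 1) < MInv) (mN : ℕ) (hnbr : ∀ (j : J) (y' : IBondY (f j).toKIdx), (nbr (geo9Y (f j)) (2 * ((d : ℝ) + 1)) y').card ≤ mN)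
    (d261 : ℝ → ℕ)
    (h261 : ∀ (j : J) (δ α : ℝ), 0 < δ → δ ≤ 1 → 9 / 5000 ≤ α → α < 1 →
      (gFrame₅CodedOn P f c35 G par parB b ιB C37 C38 hι hG1 hpar hunit M₂ hM₂ hrepr hcR Cq hCq hC37 MInv aInv aW hMInv haInv haW hunitX hsym hunitA hparB hb₁ C₀
        hC₀ hreg335P hC37G cVar hcVar hvarB hMd mN hnbr).M261 δ ≤ (geo9Y (f j)).M →
      Ineq261 (d261 δ) (toB6 (geo9Y (f j)) 0 True) δ α) :
    StepGlobPos (d + 1) c35 (fun j => geo9Y (f j)) (fun j => (codingYx P G (f j) (C37 j) (C38 j)).bg) (fun j => KSC P G (f j) (par j) (C37 j) (C38 j))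
      (fun j => KACU P G (f j) (GAY (f j).toKIdx (par j) (parB j) (GpY (f j).toKIdx (par j))) (parB j) (C37 j) (C38 j))
      (fun j => pullS (codingYx P G (f j) (C37 j) (C38 j)) (CinvY P f G par j))
      (fun j => KACU P G (f j) (GAY (f j).toKIdx (par j) (parB j) (GpY (f j).toKIdx (par j))) (parB j) (C37 j) (C38 j)) := by
  refine stepPos_blk_of_family_pos (d + 1) c35 (fun j => geo9Y (f j)) (fun j => (codingYx P G (f j) (C37 j) (C38 j)).bg)
    (fun j => KSC P G (f j) (par j) (C37 j) (C38 j)) (fun j => KSC P G (f j) (par j) (C37 j) (C38 j))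
    (fun j => KACU P G (f j) (GAY (f j).toKIdx (par j) (parB j) (GpY (f j).toKIdx (par j))) (parB j) (C37 j) (C38 j))
    (fun j => KACU P G (f j) (GAY (f j).toKIdx (par j) (parB j) (GpY (f j).toKIdx (par j))) (parB j) (C37 j) (C38 j))
    (fun j => pullS (codingYx P G (f j) (C37 j) (C38 j)) (CinvY P f G par j))
    (C₁ := ℝ × ℝ) (C₂ := ℝ) (pos₁ := fun c => 0 < c.1 ∧ 0 < c.2) (pos₂ := fun c => 0 < c)
    (Blk₁ := fun c j W => EBlock (KACU P G (f j) (GAY (f j).toKIdx (par j) (parB j) (GpY (f j).toKIdx (par j))) (parB j) (C37 j) (C38 j)) c.1 c.2 W)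
    (Blk₂ := fun c j W => GlobBlock (KACU P G (f j) (GAY (f j).toKIdx (par j) (parB j) (GpY (f j).toKIdx (par j))) (parB j) (C37 j) (C38 j)) c W)
    (fun B₀ δ₀ Bβ Bε Bεβ B₁ δ₁ hB₀ hδ₀ hB₁ hδ₁ =>
      ⟨0, 1, B₀, δ₀, Bβ, Bε, Bεβ, B₁, δ₁, one_pos, hB₀, hδ₀, hB₁, hδ₁, fun _ _ _ _ _ _ _ hT => hT⟩)
    (fun c hc a ha => ?_)
    (stepEPos_KACU_frame_on P f c35 G par parB b ιB C37 C38 hι hG1 hpar hunit M₂ hM₂ hrepr hcR Cq hCq hC37 MInv aInv aW hMInv haInv haW hunitX hsym hunitA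
      hparB hb₁ C₀ hC₀ hreg335P hC37G cVar hcVar hvarB hMd mN hnbr d261 h261)
  obtain ⟨Mg, Cg, hCg, H⟩ := globBlock_KACU_prod_of_eBlock P (𝔸 := 𝔸) (d := d) (ℓ := ℓ) (hd := hd) (hL := hL) (b₀ := b₀) (b₁ := b₁) (Mstar := Mstar) G hc.2
  refine ⟨Mg, 1, a, c.1 * (Cg + 1), one_pos, ha, le_rfl, mul_pos hc.1 (by linarith), ?_⟩
  intro j hM α₀ hα₀ _ W hreg α₁ _ _ W' h37 hE
  obtain ⟨U, rfl, -⟩ := (codingYx P G (f j) (C37 j) (C38 j)).exists_of_bg_Reg335 hreg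
  obtain ⟨U', a', hcU, rfl, -⟩ := (codingYx P G (f j) (C37 j) (C38 j)).exists_of_bg_Cplx337 h37
  cases hcU
  have hG := H (f j) (ιB j) (hι j) hM (GAY (f j).toKIdx (par j) (parB j) (GpY (f j).toKIdx (par j))) (parB j) (C37 j) (C38 j) U a' c.1 hc.1.le hE
  exact globBlock_mono_const P G (f j) _ (parB j) (C37 j) (C38 j) hG (mul_le_mul_of_nonneg_left (by linarith) hc.1.le)

end Glob

section Assembly

variable (C37 : ∀ j : J, ℝ → CfgY 𝔸 (f j).toKIdx → AfldY 𝔸 (f j).toKIdx → Prop)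

/-- ★★★ **THE ROW-13 TARGET OF RECORD `SectBStepU` — print's Sect. B step («Thus Theorem 3.4 is proved, assuming that Theorems 3.1–3.3 hold», p.407) in
U-LETTERS (letters at the base `U`, operators at the product `U′U`; node00-def-Y's ruling R13-U1 on dag-n06-c's LOCATED-11) — PROVED on a subfamily
`f : J → MemberY` with sections `ιB` AT NODE 00's LETTERS**: transporters `par := parSymY` (reversal law by `Node00.parSymY_inv_symm`), bond letters
`OA := GAY … (parSymY) (parBY) (GpY … parSymY)`, `parB := parBY` (`hparB` by `hparB_parBY`, the bond Lipschitz law `hLipB` by `hLipB_parBY`), C⁻¹ kernel `CinvY … parSymY`,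
analyticity pin `IsAnKY`; ASSEMBLED by `B9SectBStepWhole.sectBStepPrinted_of_posBlockSteps` from dag-n06-c's landed members — G′ side (`KSCU`):
`stepEPos ∕ stepGlobPos ∕ stepL2Pos_KSCU_on`, `stepH1Pos_KSCU_parSymY_on`, `stepE4Pos ∕ stepH2Pos_KSCU_on`, `stepKerPos_KSCU_parSymY_on`, `stepAnalyticPos_KSCU_on`;
G side (`KACU`, through the frames `gFrame₅CodedOn ∕ h1GFrame₆CodedOn ∕ e4h2GFrame₆CodedOn ∕ l2GFrame₈CodedOn`): `stepEPos_KACU_frame_on`, §1 `stepGlobPos_KACU_frame_on`,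
`stepH1Pos_KACU_frame_parBY_on`, `stepE4Pos ∕ stepH2Pos_KACU_frame_on`, `stepL2Pos_KACU_frame₈_on … (read377L2_gFrame₅CodedOn …)` ((3.77) in block-ℓ² PROVED there),
each moved to the `KSCU` input slot by §2.  DISPLAYED (the union of the members' binders, nothing new): structural `hι hG1 b M₂ hrepr hcR hcL`, the positivity
data `MInv aInv aW`, the G′-side laws `hpar hunit hunitX` (facts of the matrix algebra at `parSymY`, discharged for `G ≦ U(N)` in `…_unitary`-type corollaries:
`Node00.parSymY_mem`, `isUnit_deltaPrimeAY_parSymY`, `isUnit_XY_parSymY`), the coded-class dictionaries `hC37 hC37G hvarB` (projections for `C37 := C37GY`,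
`sectBStepU_C37GY_of_members`), the G-side laws `hunitA` (Theorem 3.1's input: `Δ_a(U)` invertible), `hb₁ C₀ hreg335P` ((3.35) on plaquettes), the cell numerics
`hMd mN hnbr hMr`, the GUARDED L² plaquette law `hplaq` (thresholds `MInv`, `aInv`), the Lemma-2.1 datum `(d261, h261)` at the frames' threshold, and the RECORD's Theorems 3.2 ∕ 3.3 `h32 h33`
(the step's printed premise). [cite: Balaban1985BackgroundPropagators, Thm 3.4 p.400, Sect. B (3.50)–(3.86) pp.400–407, p.403 l.1–9, p.407 («Thus Theorem 3.4 is proved, assuming that Theorems 3.1–3.3 hold»), Thms 3.1–3.3 (3.42)–(3.48) pp.397–399, (3.35)–(3.37) p.396, (3.77) p.406; Balaban1984PropagatorsII, Lemma 2.1 p.234, (2.45) p.231, (2.51) p.232] -/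
theorem sectBStepU_of_members_g (hι : ∀ (j : J) (s : BlkY (f j).toKIdx), β (f j).toKIdx.hN (f j).toKIdx.D (f j).toKIdx.hk (ιB j s) = s)
    (hG1 : ∀ u : 𝔸ˣ, u ∈ G → ‖(u : 𝔸)‖ ≤ 1)
    (hpar : ∀ j (U : CfgY 𝔸 (f j).toKIdx), GVal G (f j).toKIdx U → ∀ z w, parSymY (f j).toKIdx U z w ∈ G)
    (hunit : ∀ j (U : CfgY 𝔸 (f j).toKIdx), GVal G (f j).toKIdx U → IsUnit (deltaPrimeAY (f j).toKIdx (parSymY (f j).toKIdx) U))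
    (M₂ : ℝ) (hM₂ : 0 ≤ M₂) (hrepr : ∀ (v : 𝔸) (j : ι), |b.repr v j| ≤ M₂ * ‖v‖) (hcR : 0 < M₂ * ∑ j, ‖b j‖)
    (hcL : 0 < Real.sqrt (Fintype.card ι) * M₂ * ∑ j, ‖b j‖)
    (Cq : ℝ) (hCq : 0 ≤ Cq)
    (hC37 : ∀ j β' U a, C37 j β' U a → GVal G (f j).toKIdx U ∧ CplxLettersY G (f j) (parSymY (f j).toKIdx) (ιB j) Cq β' U a)
    (MInv aInv aW : ℝ) (hMInv : 0 < MInv) (haInv : 0 < aInv) (haW : 0 < aW)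
    (hunitX : ∀ j (U : CfgY 𝔸 (f j).toKIdx), GVal G (f j).toKIdx U →
      IsUnit (XY (f j).toKIdx (parSymY (f j).toKIdx) (GpY (f j).toKIdx (parSymY (f j).toKIdx)) U))
    (hunitA : ∀ j (α₀ : ℝ) (U : CfgY 𝔸 (f j).toKIdx), MInv ≤ (geo9Y (f j)).M → 0 < α₀ → (geo9Y (f j)).M * α₀ ≤ aInv →
      (bg9YC 𝔸 G P (f j)).Reg335 c35 α₀ U →
      IsUnit (deltaAY (f j).toKIdx (parSymY (f j).toKIdx) (parBY (f j).toKIdx) (GpY (f j).toKIdx (parSymY (f j).toKIdx)) U)) (hb₁ : 0 ≤ b₁)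
    (C₀ : ℝ) (hC₀ : 0 ≤ C₀)
    (hreg335P : ∀ j (α₀ : ℝ) (U : CfgY 𝔸 (f j).toKIdx), MInv ≤ (geo9Y (f j)).M → 0 < α₀ → (geo9Y (f j)).M * α₀ ≤ aInv →
      (bg9YC 𝔸 G P (f j)).Reg335 c35 α₀ U → Reg335PlaqY G (f j) (ιB j) C₀ U)
    (hC37G : ∀ j β' U a, C37 j β' U a → CplxLettersGY G (f j) (ιB j) β' U a)
    (cVar : ℝ) (hcVar : 0 ≤ cVar) (hvarB : ∀ j β' U a, C37 j β' U a → VarParBY (f j).toKIdx (parBY (f j).toKIdx) cVar β' U a)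
    (hMd : 2 * ((d : ℝ) + 1) < MInv) (mN : ℕ) (hnbr : ∀ (j : J) (y' : IBondY (f j).toKIdx), (nbr (geo9Y (f j)) (2 * ((d : ℝ) + 1)) y').card ≤ mN)
    (hMr : rLB d ℓ + 1 < MInv) {cP : ℝ} (hcP : 0 ≤ cP)
    (hplaq : ∀ (j : J) (α₀ : ℝ) (U : CfgY 𝔸 (f j).toKIdx), MInv ≤ (geo9Y (f j)).M → 0 < α₀ → (geo9Y (f j)).M * α₀ ≤ aInv →
      (bg9YC 𝔸 G P (f j)).Reg335 c35 α₀ U → PlaqLawY (f j) (ιB j) cP U)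
    (d261 : ℝ → ℕ)
    (h261 : ∀ (j : J) (δ α : ℝ), 0 < δ → δ ≤ 1 → 9 / 5000 ≤ α → α < 1 →
      (gFrame₅CodedOn P f c35 G (fun j => parSymY (f j).toKIdx) (fun j => parBY (f j).toKIdx) b ιB C37 C38 hι hG1 hpar hunit M₂ hM₂ hrepr hcR Cq hCq hC37 MInv
        aInv aW hMInv haInv haW hunitX (fun _ U z w => parSymY_inv_symm U z w) hunitA (hparB_parBY f G) hb₁ C₀ hC₀ hreg335P hC37G cVar hcVar hvarB hMd mN
        hnbr).M261 δ ≤ (geo9Y (f j)).M →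
      Ineq261 (d261 δ) (toB6 (geo9Y (f j)) 0 True) δ α)
    (h32 : B9.Thm32Printed (d + 1) c35 (fun j => geo9Y (f j)) (fun j => bg9YC 𝔸 G P (f j)) (CinvY P f G (fun j => parSymY (f j).toKIdx)))
    (h33 : B9.Thm33Printed c35 (fun j => geo9Y (f j)) (fun j => bg9YC 𝔸 G P (f j))
      (fun j => kernelFamilyS (f j).toKIdx (bg9YC 𝔸 G P (f j)) (fun U => U) (GpY (f j).toKIdx (parSymY (f j).toKIdx)) (parSymY (f j).toKIdx))
      (fun j => kernelFamilyB (f j).toKIdx (bg9YC 𝔸 G P (f j)) (fun U => U)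
        (GAY (f j).toKIdx (parSymY (f j).toKIdx) (parBY (f j).toKIdx) (GpY (f j).toKIdx (parSymY (f j).toKIdx))) (parBY (f j).toKIdx))) :
    SectBStepU P f (d + 1) c35 G b (fun j => parSymY (f j).toKIdx)
      (fun j => GAY (f j).toKIdx (parSymY (f j).toKIdx) (parBY (f j).toKIdx) (GpY (f j).toKIdx (parSymY (f j).toKIdx))) (fun j => parBY (f j).toKIdx)
      C37 C38 (CinvY P f G (fun j => parSymY (f j).toKIdx)) := by
  have hsym : ∀ j (U : CfgY 𝔸 (f j).toKIdx) (z w : SiteY (f j).toKIdx), parSymY (f j).toKIdx U z w = (parSymY (f j).toKIdx U w z)⁻¹ :=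
    fun _ U z w => parSymY_inv_symm U z w
  -- the G side: six frame steps at the `KSC` input slot, moved to the `KSCU` slot (§2)
  have hEa := stepPos_KSCU_of_KSC P f c35 G b ιB C38 (fun j => parSymY (f j).toKIdx) _ (fun j => parBY (f j).toKIdx) C37 _ hι hG1 hM₂ hrepr (d + 1)
    (stepEPos_KACU_frame_on P f c35 G (fun j => parSymY (f j).toKIdx) (fun j => parBY (f j).toKIdx) b ιB C37 C38 hι hG1 hpar hunit M₂ hM₂ hrepr hcR Cq hCq hC37
      MInv aInv aW hMInv haInv haW hunitX hsym hunitA (hparB_parBY f G) hb₁ C₀ hC₀ hreg335P hC37G cVar hcVar hvarB hMd mN hnbr d261 h261)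
  have hGa := stepPos_KSCU_of_KSC P f c35 G b ιB C38 (fun j => parSymY (f j).toKIdx) _ (fun j => parBY (f j).toKIdx) C37 _ hι hG1 hM₂ hrepr (d + 1)
    (stepGlobPos_KACU_frame_on P f c35 G b ιB C38 (fun j => parSymY (f j).toKIdx) (fun j => parBY (f j).toKIdx) C37 hι hG1 hpar hunit M₂ hM₂ hrepr hcR Cq hCq hC37
      MInv aInv aW hMInv haInv haW hunitX hsym hunitA (hparB_parBY f G) hb₁ C₀ hC₀ hreg335P hC37G cVar hcVar hvarB hMd mN hnbr d261 h261)
  have hH1a := stepPos_KSCU_of_KSC P f c35 G b ιB C38 (fun j => parSymY (f j).toKIdx) _ (fun j => parBY (f j).toKIdx) C37 _ hι hG1 hM₂ hrepr (d + 1)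
    (stepH1Pos_KACU_frame_parBY_on P f c35 G (fun j => parSymY (f j).toKIdx) b ιB C37 C38 hι hG1 hpar hunit M₂ hM₂ hrepr hcR Cq hCq hC37 MInv aInv aW hMInv
      haInv haW hunitX hsym hunitA hb₁ C₀ hC₀ hreg335P hC37G cVar hcVar hvarB hMd mN hnbr hMr d261 h261)
  have hE4a := stepPos_KSCU_of_KSC P f c35 G b ιB C38 (fun j => parSymY (f j).toKIdx) _ (fun j => parBY (f j).toKIdx) C37 _ hι hG1 hM₂ hrepr (d + 1)
    (stepE4Pos_KACU_frame_on P f c35 G (fun j => parSymY (f j).toKIdx) (fun j => parBY (f j).toKIdx) b ιB C37 C38 hι hG1 hpar hunit M₂ hM₂ hrepr hcR Cq hCq hC37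
      MInv aInv aW hMInv haInv haW hunitX hsym hunitA (hparB_parBY f G) hb₁ C₀ hC₀ hreg335P hC37G cVar hcVar hvarB hMd mN hnbr d261 h261)
  have hH2a := stepPos_KSCU_of_KSC P f c35 G b ιB C38 (fun j => parSymY (f j).toKIdx) _ (fun j => parBY (f j).toKIdx) C37 _ hι hG1 hM₂ hrepr (d + 1)
    (stepH2Pos_KACU_frame_on P f c35 G (fun j => parSymY (f j).toKIdx) (fun j => parBY (f j).toKIdx) b ιB C37 C38 hι hG1 hpar hunit M₂ hM₂ hrepr hcR Cq hCq hC37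
      MInv aInv aW hMInv haInv haW hunitX hsym hunitA (hparB_parBY f G) hb₁ C₀ hC₀ hreg335P hC37G cVar hcVar hvarB hMd mN hnbr d261 h261)
  have hLa := stepPos_KSCU_of_KSC P f c35 G b ιB C38 (fun j => parSymY (f j).toKIdx) _ (fun j => parBY (f j).toKIdx) C37 _ hι hG1 hM₂ hrepr (d + 1)
    (stepL2Pos_KACU_frame₈_on P f c35 G (fun j => parSymY (f j).toKIdx) (fun j => parBY (f j).toKIdx) b ιB C37 C38 hι hG1 hpar hunit M₂ hM₂ hrepr hcR Cq hCq hC37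
      MInv aInv aW hMInv haInv haW hunitX hsym hunitA (hparB_parBY f G) hb₁ C₀ hC₀ hreg335P hC37G cVar hcVar hvarB hMd mN hnbr
      (read377L2_gFrame₅CodedOn P f c35 G (fun j => parSymY (f j).toKIdx) (fun j => parBY (f j).toKIdx) b ιB C37 C38 hι hG1 hpar hunit M₂ hM₂ hrepr hcR Cq hCq
        hC37 MInv aInv aW hMInv haInv haW hunitX hsym hunitA (hparB_parBY f G) hb₁ C₀ hC₀ hreg335P hC37G cVar hcVar hvarB hMd mN hnbr) d261 h261)
  -- the G′ side: dag-n06-c's eight `KSCU` members at `par := parSymY`, `OA := GAY …`, `Cinv := CinvY …`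
  exact sectBStepPrinted_of_posBlockSteps (fun j => modelSignsOn_geo9K (f j).toKIdx)
    (thm32Printed_codedU P f c35 G C38 C37 _ (d + 1) h32) (thm33Printed_codedU P f c35 G C38 (fun j => parSymY (f j).toKIdx) _ (fun j => parBY (f j).toKIdx) C37 h33)
    (stepAnalyticPos_KSCU_on P f c35 G (fun j => parSymY (f j).toKIdx) _ (fun j => parBY (f j).toKIdx) b ιB C37 C38 _ hι hG1 hpar hunit (d + 1) M₂ hM₂ hrepr hcR Cq
      hCq hC37 MInv aInv aW hMInv haInv haW)
    (stepEPos_KSCU_on P f c35 G (fun j => parSymY (f j).toKIdx) _ (fun j => parBY (f j).toKIdx) b ιB C37 C38 _ hι hG1 hpar hunit (d + 1) M₂ hM₂ hrepr hcR Cq hCq hC37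
      MInv aInv aW hMInv haInv haW)
    (stepL2Pos_KSCU_on_g P f c35 G (fun j => parSymY (f j).toKIdx) _ (fun j => parBY (f j).toKIdx) b ιB C37 C38 _ hι hG1 hpar hunit (d + 1) M₂ hM₂ hrepr hcR hcL Cq hCq
      hC37 MInv aInv aW hMInv haInv haW hcP hplaq)
    (stepGlobPos_KSCU_on P f c35 G (fun j => parSymY (f j).toKIdx) _ (fun j => parBY (f j).toKIdx) b ιB C37 C38 _ hι hG1 hpar hunit (d + 1) M₂ hM₂ hrepr hcR Cq hCq
      hC37 MInv aInv aW hMInv haInv haW)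
    (stepH1Pos_KSCU_parSymY_on P f c35 G _ (fun j => parBY (f j).toKIdx) b ιB C37 C38 _ hι hG1 hpar hunit (d + 1) M₂ hM₂ hrepr hcR Cq hCq hC37 MInv aInv aW hMInv
      haInv haW)
    (stepE4Pos_KSCU_on P f c35 G (fun j => parSymY (f j).toKIdx) _ (fun j => parBY (f j).toKIdx) b ιB C37 C38 _ hι hG1 hpar hunit (d + 1) M₂ hM₂ hrepr hcR Cq hCq
      hC37 MInv aInv aW hMInv haInv haW)
    (stepH2Pos_KSCU_on P f c35 G (fun j => parSymY (f j).toKIdx) _ (fun j => parBY (f j).toKIdx) b ιB C37 C38 _ hι hG1 hpar hunit (d + 1) M₂ hM₂ hrepr hcR Cq hCq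
      hC37 MInv aInv aW hMInv haInv haW)
    (stepKerPos_KSCU_parSymY_on P f c35 G _ (fun j => parBY (f j).toKIdx) b ιB C37 C38 hι hG1 hpar hunit M₂ hM₂ hrepr hcR Cq hCq hC37 MInv aInv aW hMInv haInv haW
      hunitX)
    hEa hLa hGa hH1a hE4a hH2a

/-- ★★ **THEOREM 3.4 OF RECORD `Thm34U` (print's reading) on the subfamily at NODE 00's letters** — «Thus Theorem 3.4 is proved, assuming that Theorems 3.1–3.3
hold» (p.407): `B9.thm34_of_sectB` on `sectBStepU_of_members` and the record's Theorems 3.2 ∕ 3.3 read over the coded carrier (§3); same binders.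
[cite: Balaban1985BackgroundPropagators, Thm 3.4 p.400, Sect. B p.407, Thms 3.2–3.3 pp.398–399] -/
theorem thm34U_of_members_g (hι : ∀ (j : J) (s : BlkY (f j).toKIdx), β (f j).toKIdx.hN (f j).toKIdx.D (f j).toKIdx.hk (ιB j s) = s)
    (hG1 : ∀ u : 𝔸ˣ, u ∈ G → ‖(u : 𝔸)‖ ≤ 1)
    (hpar : ∀ j (U : CfgY 𝔸 (f j).toKIdx), GVal G (f j).toKIdx U → ∀ z w, parSymY (f j).toKIdx U z w ∈ G)
    (hunit : ∀ j (U : CfgY 𝔸 (f j).toKIdx), GVal G (f j).toKIdx U → IsUnit (deltaPrimeAY (f j).toKIdx (parSymY (f j).toKIdx) U))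
    (M₂ : ℝ) (hM₂ : 0 ≤ M₂) (hrepr : ∀ (v : 𝔸) (j : ι), |b.repr v j| ≤ M₂ * ‖v‖) (hcR : 0 < M₂ * ∑ j, ‖b j‖)
    (hcL : 0 < Real.sqrt (Fintype.card ι) * M₂ * ∑ j, ‖b j‖)
    (Cq : ℝ) (hCq : 0 ≤ Cq)
    (hC37 : ∀ j β' U a, C37 j β' U a → GVal G (f j).toKIdx U ∧ CplxLettersY G (f j) (parSymY (f j).toKIdx) (ιB j) Cq β' U a)
    (MInv aInv aW : ℝ) (hMInv : 0 < MInv) (haInv : 0 < aInv) (haW : 0 < aW)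
    (hunitX : ∀ j (U : CfgY 𝔸 (f j).toKIdx), GVal G (f j).toKIdx U →
      IsUnit (XY (f j).toKIdx (parSymY (f j).toKIdx) (GpY (f j).toKIdx (parSymY (f j).toKIdx)) U))
    (hunitA : ∀ j (α₀ : ℝ) (U : CfgY 𝔸 (f j).toKIdx), MInv ≤ (geo9Y (f j)).M → 0 < α₀ → (geo9Y (f j)).M * α₀ ≤ aInv →
      (bg9YC 𝔸 G P (f j)).Reg335 c35 α₀ U →
      IsUnit (deltaAY (f j).toKIdx (parSymY (f j).toKIdx) (parBY (f j).toKIdx) (GpY (f j).toKIdx (parSymY (f j).toKIdx)) U)) (hb₁ : 0 ≤ b₁)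
    (C₀ : ℝ) (hC₀ : 0 ≤ C₀)
    (hreg335P : ∀ j (α₀ : ℝ) (U : CfgY 𝔸 (f j).toKIdx), MInv ≤ (geo9Y (f j)).M → 0 < α₀ → (geo9Y (f j)).M * α₀ ≤ aInv →
      (bg9YC 𝔸 G P (f j)).Reg335 c35 α₀ U → Reg335PlaqY G (f j) (ιB j) C₀ U)
    (hC37G : ∀ j β' U a, C37 j β' U a → CplxLettersGY G (f j) (ιB j) β' U a)
    (cVar : ℝ) (hcVar : 0 ≤ cVar) (hvarB : ∀ j β' U a, C37 j β' U a → VarParBY (f j).toKIdx (parBY (f j).toKIdx) cVar β' U a)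
    (hMd : 2 * ((d : ℝ) + 1) < MInv) (mN : ℕ) (hnbr : ∀ (j : J) (y' : IBondY (f j).toKIdx), (nbr (geo9Y (f j)) (2 * ((d : ℝ) + 1)) y').card ≤ mN)
    (hMr : rLB d ℓ + 1 < MInv) {cP : ℝ} (hcP : 0 ≤ cP)
    (hplaq : ∀ (j : J) (α₀ : ℝ) (U : CfgY 𝔸 (f j).toKIdx), MInv ≤ (geo9Y (f j)).M → 0 < α₀ → (geo9Y (f j)).M * α₀ ≤ aInv →
      (bg9YC 𝔸 G P (f j)).Reg335 c35 α₀ U → PlaqLawY (f j) (ιB j) cP U)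
    (d261 : ℝ → ℕ)
    (h261 : ∀ (j : J) (δ α : ℝ), 0 < δ → δ ≤ 1 → 9 / 5000 ≤ α → α < 1 →
      (gFrame₅CodedOn P f c35 G (fun j => parSymY (f j).toKIdx) (fun j => parBY (f j).toKIdx) b ιB C37 C38 hι hG1 hpar hunit M₂ hM₂ hrepr hcR Cq hCq hC37 MInv
        aInv aW hMInv haInv haW hunitX (fun _ U z w => parSymY_inv_symm U z w) hunitA (hparB_parBY f G) hb₁ C₀ hC₀ hreg335P hC37G cVar hcVar hvarB hMd mN
        hnbr).M261 δ ≤ (geo9Y (f j)).M →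
      Ineq261 (d261 δ) (toB6 (geo9Y (f j)) 0 True) δ α)
    (h32 : B9.Thm32Printed (d + 1) c35 (fun j => geo9Y (f j)) (fun j => bg9YC 𝔸 G P (f j)) (CinvY P f G (fun j => parSymY (f j).toKIdx)))
    (h33 : B9.Thm33Printed c35 (fun j => geo9Y (f j)) (fun j => bg9YC 𝔸 G P (f j))
      (fun j => kernelFamilyS (f j).toKIdx (bg9YC 𝔸 G P (f j)) (fun U => U) (GpY (f j).toKIdx (parSymY (f j).toKIdx)) (parSymY (f j).toKIdx))
      (fun j => kernelFamilyB (f j).toKIdx (bg9YC 𝔸 G P (f j)) (fun U => U)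
        (GAY (f j).toKIdx (parSymY (f j).toKIdx) (parBY (f j).toKIdx) (GpY (f j).toKIdx (parSymY (f j).toKIdx))) (parBY (f j).toKIdx))) :
    Thm34U P f c35 G b (fun j => parSymY (f j).toKIdx)
      (fun j => GAY (f j).toKIdx (parSymY (f j).toKIdx) (parBY (f j).toKIdx) (GpY (f j).toKIdx (parSymY (f j).toKIdx))) (fun j => parBY (f j).toKIdx)
      C37 C38 :=
  B9.thm34_of_sectB (d + 1) c35 (fun j => geo9Y (f j)) (fun j => (codingYx P G (f j) (C37 j) (C38 j)).bg)
    (fun j => KSCU P G (f j) (parSymY (f j).toKIdx) (C37 j) (C38 j))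
    (fun j => KACU P G (f j) (GAY (f j).toKIdx (parSymY (f j).toKIdx) (parBY (f j).toKIdx) (GpY (f j).toKIdx (parSymY (f j).toKIdx))) (parBY (f j).toKIdx) (C37 j) (C38 j))
    (fun j => pullS (codingYx P G (f j) (C37 j) (C38 j)) (CinvY P f G (fun j => parSymY (f j).toKIdx) j)) (fun j => IsAnKY P G (f j) (parSymY (f j).toKIdx) b (C37 j) (C38 j))
    (sectBStepU_of_members_g P f c35 G b ιB C38 C37 hι hG1 hpar hunit M₂ hM₂ hrepr hcR hcL Cq hCq hC37 MInv aInv aW hMInv haInv haW hunitX hunitA hb₁ C₀ hC₀ hreg335P hC37G cVar hcVar hvarB hMd mN hnbr hMr hcP hplaq d261 h261 h32 h33)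
    (thm32Printed_codedU P f c35 G C38 C37 _ (d + 1) h32) (thm33Printed_codedU P f c35 G C38 (fun j => parSymY (f j).toKIdx) _ (fun j => parBY (f j).toKIdx) C37 h33)

end Assembly

end General

section Unitary

open scoped Matrix.Norms.L2Operator
open B9Thm311DeltaPrimePos (isUnit_deltaPrimeAY_parSymY)
open B9Thm311PosAtRecordV4 (isUnit_XY_parSymY)
open Node00 (parSymY_mem)

open scoped Matrix.Norms.L2Operator
open B9Thm311DeltaPrimePos (isUnit_deltaPrimeAY_parSymY)
open B9Thm311PosAtRecordV4 (isUnit_XY_parSymY)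
open Node00 (parSymY_mem)

variable {N : ℕ} (P : RegExtraY d ℓ hd hL b₀ b₁ Mstar (Matrix (Fin N) (Fin N) ℂ)) {J : Type} (f : J → MemberY d ℓ hd hL b₀ b₁ Mstar) [∀ x : MemberY d ℓ hd hL b₀ b₁ Mstar, Fintype (geo9Y x).Site]
  [instDS : ∀ x : MemberY d ℓ hd hL b₀ b₁ Mstar, DecidableEq (geo9Y x).Site] [instNE : ∀ x : MemberY d ℓ hd hL b₀ b₁ Mstar, Nonempty (geo9Y x).Site]
  (c35 : ℝ) (G : Subgroup (Matrix (Fin N) (Fin N) ℂ)ˣ) {ι : Type} [Fintype ι] [DecidableEq ι] (b : Module.Basis ι ℝ (Matrix (Fin N) (Fin N) ℂ))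
  (ιB : ∀ j : J, BlkY (f j).toKIdx → IBondY (f j).toKIdx)
  (C38 : ∀ j : J, ℝ → CfgY (Matrix (Fin N) (Fin N) ℂ) (f j).toKIdx → AfldY (Matrix (Fin N) (Fin N) ℂ) (f j).toKIdx → Prop)

/-- ★★★ **`SectBStepU` AT THE RECORD's LETTERS FOR `𝔸 = M_N(ℂ)`, `G ≦ U(N)`, CODED CLASS `C37GY`** (`Cq = 4(d+1)e^{3(d+1)/2}`, `cVar = cVarGY d ℓ`): §4 with the
G′-side laws DISCHARGED (`hpar` by `Node00.parSymY_mem`, `hunit` by `isUnit_deltaPrimeAY_parSymY`, `hunitX` by `isUnit_XY_parSymY` — Theorem 3.11's positivity) and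
the class dictionaries DISCHARGED (`hC37 ∕ hC37G ∕ hvarB` = the projections of dag-n06-c's `B9SectBCodedClassGY`).  STILL DISPLAYED: structural `hι hG1 b M₂ hrepr hcR hcL`,
positivity data `MInv aInv aW`, the G-side law `hunitA` (Theorem 3.1's input), `hb₁ C₀ hreg335P` ((3.35) on plaquettes), the cell numerics `hMd mN hnbr hMr`, the GUARDED L² plaquette
law `hplaq`, the Lemma-2.1 datum `(d261, h261)`, the record's Theorems 3.2 ∕ 3.3 `h32 h33`. [cite: Balaban1985BackgroundPropagators, Thm 3.4 p.400, Sect. B pp.400–407, p.407, Thm 3.11 p.416, p.395, (3.35)–(3.37) p.396; Balaban1984PropagatorsII, Lemma 2.1 p.234, (2.45) p.231, (2.51) p.232] -/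
theorem sectBStepU_C37GY_unitary_of_members_g [NormOneClass (Matrix (Fin N) (Fin N) ℂ)] [FiniteDimensional ℝ (Matrix (Fin N) (Fin N) ℂ)]
    (hG : G ≤ B7Prop2Explicit.unitaryUnits (Matrix (Fin N) (Fin N) ℂ))
    (hι : ∀ (j : J) (s : BlkY (f j).toKIdx), β (f j).toKIdx.hN (f j).toKIdx.D (f j).toKIdx.hk (ιB j s) = s)
    (hG1 : ∀ u : (Matrix (Fin N) (Fin N) ℂ)ˣ, u ∈ G → ‖(u : Matrix (Fin N) (Fin N) ℂ)‖ ≤ 1)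
    (M₂ : ℝ) (hM₂ : 0 ≤ M₂) (hrepr : ∀ (v : Matrix (Fin N) (Fin N) ℂ) (j : ι), |b.repr v j| ≤ M₂ * ‖v‖) (hcR : 0 < M₂ * ∑ j, ‖b j‖)
    (hcL : 0 < Real.sqrt (Fintype.card ι) * M₂ * ∑ j, ‖b j‖)
    (MInv aInv aW : ℝ) (hMInv : 0 < MInv) (haInv : 0 < aInv) (haW : 0 < aW)
    (hunitA : ∀ j (α₀ : ℝ) (U : CfgY (Matrix (Fin N) (Fin N) ℂ) (f j).toKIdx), MInv ≤ (geo9Y (f j)).M → 0 < α₀ → (geo9Y (f j)).M * α₀ ≤ aInv →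
      (bg9YC (Matrix (Fin N) (Fin N) ℂ) G P (f j)).Reg335 c35 α₀ U →
      IsUnit (deltaAY (f j).toKIdx (parSymY (f j).toKIdx) (parBY (f j).toKIdx) (GpY (f j).toKIdx (parSymY (f j).toKIdx)) U)) (hb₁ : 0 ≤ b₁)
    (C₀ : ℝ) (hC₀ : 0 ≤ C₀)
    (hreg335P : ∀ j (α₀ : ℝ) (U : CfgY (Matrix (Fin N) (Fin N) ℂ) (f j).toKIdx), MInv ≤ (geo9Y (f j)).M → 0 < α₀ → (geo9Y (f j)).M * α₀ ≤ aInv →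
      (bg9YC (Matrix (Fin N) (Fin N) ℂ) G P (f j)).Reg335 c35 α₀ U →
        Reg335PlaqY G (f j) (ιB j) C₀ U)
    (hMd : 2 * ((d : ℝ) + 1) < MInv) (mN : ℕ) (hnbr : ∀ (j : J) (y' : IBondY (f j).toKIdx), (nbr (geo9Y (f j)) (2 * ((d : ℝ) + 1)) y').card ≤ mN)
    (hMr : rLB d ℓ + 1 < MInv) {cP : ℝ} (hcP : 0 ≤ cP)
    (hplaq : ∀ (j : J) (α₀ : ℝ) (U : CfgY (Matrix (Fin N) (Fin N) ℂ) (f j).toKIdx), MInv ≤ (geo9Y (f j)).M → 0 < α₀ → (geo9Y (f j)).M * α₀ ≤ aInv →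
      (bg9YC (Matrix (Fin N) (Fin N) ℂ) G P (f j)).Reg335 c35 α₀ U → PlaqLawY (f j) (ιB j) cP U)
    (d261 : ℝ → ℕ)
    (h261 : ∀ (j : J) (δ α : ℝ), 0 < δ → δ ≤ 1 → 9 / 5000 ≤ α → α < 1 →
      (gFrame₅CodedOn P f c35 G (fun j => parSymY (f j).toKIdx) (fun j => parBY (f j).toKIdx) b ιB
        (fun j => C37GY G (f j) (ιB j) (4 * ((d : ℝ) + 1) * Real.exp (3 * (((d : ℝ) + 1) / 2)))) C38 hι hG1 (fun j _ hU z w => parSymY_mem (f j).toKIdx hU z w)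
        (fun j _ hU => isUnit_deltaPrimeAY_parSymY (f j).toKIdx hG hU) M₂ hM₂ hrepr hcR (4 * ((d : ℝ) + 1) * Real.exp (3 * (((d : ℝ) + 1) / 2)))
        (by positivity) (fun j => hC37_of_C37GY G (f j) (ιB j) _) MInv aInv aW hMInv haInv haW (fun j _ hU => isUnit_XY_parSymY (f j).toKIdx hG hU)
        (fun _ U z w => parSymY_inv_symm U z w) hunitA (hparB_parBY f G) hb₁ C₀ hC₀ hreg335P (fun j => hC37G_of_C37GY G (f j) (ιB j) _) (cVarGY d ℓ)
        (cVarGY_nonneg d ℓ) (fun j => hvarB_of_C37GY G (f j) (ιB j) _) hMd mN hnbr).M261 δ ≤ (geo9Y (f j)).M →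
      Ineq261 (d261 δ) (toB6 (geo9Y (f j)) 0 True) δ α)
    (h32 : B9.Thm32Printed (d + 1) c35 (fun j => geo9Y (f j)) (fun j => bg9YC (Matrix (Fin N) (Fin N) ℂ) G P (f j)) (CinvY P f G (fun j => parSymY (f j).toKIdx)))
    (h33 : B9.Thm33Printed c35 (fun j => geo9Y (f j)) (fun j => bg9YC (Matrix (Fin N) (Fin N) ℂ) G P (f j))
      (fun j => kernelFamilyS (f j).toKIdx (bg9YC (Matrix (Fin N) (Fin N) ℂ) G P (f j)) (fun U => U) (GpY (f j).toKIdx (parSymY (f j).toKIdx))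
        (parSymY (f j).toKIdx))
      (fun j => kernelFamilyB (f j).toKIdx (bg9YC (Matrix (Fin N) (Fin N) ℂ) G P (f j)) (fun U => U)
        (GAY (f j).toKIdx (parSymY (f j).toKIdx) (parBY (f j).toKIdx) (GpY (f j).toKIdx (parSymY (f j).toKIdx))) (parBY (f j).toKIdx))) :
    SectBStepU P f (d + 1) c35 G b (fun j => parSymY (f j).toKIdx)
      (fun j => GAY (f j).toKIdx (parSymY (f j).toKIdx) (parBY (f j).toKIdx) (GpY (f j).toKIdx (parSymY (f j).toKIdx))) (fun j => parBY (f j).toKIdx)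
      (fun j => C37GY G (f j) (ιB j) (4 * ((d : ℝ) + 1) * Real.exp (3 * (((d : ℝ) + 1) / 2)))) C38 (CinvY P f G (fun j => parSymY (f j).toKIdx)) :=
  sectBStepU_of_members_g P f c35 G b ιB C38 (fun j => C37GY G (f j) (ιB j) (4 * ((d : ℝ) + 1) * Real.exp (3 * (((d : ℝ) + 1) / 2)))) hι hG1
    (fun j _ hU z w => parSymY_mem (f j).toKIdx hU z w) (fun j _ hU => isUnit_deltaPrimeAY_parSymY (f j).toKIdx hG hU) M₂ hM₂ hrepr hcR hcL _ (by positivity)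
    (fun j => hC37_of_C37GY G (f j) (ιB j) _) MInv aInv aW hMInv haInv haW (fun j _ hU => isUnit_XY_parSymY (f j).toKIdx hG hU) hunitA hb₁ C₀ hC₀ hreg335P
    (fun j => hC37G_of_C37GY G (f j) (ιB j) _) (cVarGY d ℓ) (cVarGY_nonneg d ℓ) (fun j => hvarB_of_C37GY G (f j) (ιB j) _) hMd mN hnbr hMr hcP hplaq d261 h261
    h32 h33

end Unitary

/-! ## §4 ★★★ At the record's reading of print's class: `hreg335P` and `hplaq` DISCHARGED -/

section ClassPb

open scoped Matrix.Norms.L2Operator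
open B9Thm311DeltaPrimePos (isUnit_deltaPrimeAY_parSymY)
open B9Thm311PosAtRecordV4 (isUnit_XY_parSymY)
open Node00 (parSymY_mem)
open B9SectBCodedClassR (extraYPb)
open B9SectBGReg335PlaqYOfClassPb (c335Plaq c335Plaq_nonneg hreg335P_extraYPb)
open B9SectBL2GCrossY (plaqLawY_of_reg335PlaqY)

open scoped Matrix.Norms.L2Operator
open B9Thm311DeltaPrimePos (isUnit_deltaPrimeAY_parSymY)
open B9Thm311PosAtRecordV4 (isUnit_XY_parSymY)
open Node00 (parSymY_mem)

variable {N : ℕ} {J : Type} (f : J → MemberY d ℓ hd hL b₀ b₁ Mstar) [∀ x : MemberY d ℓ hd hL b₀ b₁ Mstar, Fintype (geo9Y x).Site]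
  [instDS : ∀ x : MemberY d ℓ hd hL b₀ b₁ Mstar, DecidableEq (geo9Y x).Site] [instNE : ∀ x : MemberY d ℓ hd hL b₀ b₁ Mstar, Nonempty (geo9Y x).Site]
  (c35 : ℝ) (G : Subgroup (Matrix (Fin N) (Fin N) ℂ)ˣ) {ι : Type} [Fintype ι] [DecidableEq ι] (b : Module.Basis ι ℝ (Matrix (Fin N) (Fin N) ℂ))
  (ιB : ∀ j : J, BlkY (f j).toKIdx → IBondY (f j).toKIdx)
  (C38 : ∀ j : J, ℝ → CfgY (Matrix (Fin N) (Fin N) ℂ) (f j).toKIdx → AfldY (Matrix (Fin N) (Fin N) ℂ) (f j).toKIdx → Prop)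

/-- ★★★ **`SectBStepU` AT THE RECORD's READING OF PRINT's CLASS, BOTH PLAQUETTE DISPLAYS DISCHARGED** (`𝔸 = M_N(ℂ)`, `N ≥ 1`, `G ≦ U(N)`, coded class `C37GY`,
`P := extraYPb`): §3's `sectBStepU_C37GY_unitary_of_members_g` with `C₀ := c335Plaq ℓ aInv`, `hreg335P := hreg335P_extraYPb …` ((3.35) on the plaquettes through
each bond — dag-n06-c `B9SectBGReg335PlaqYOfClassPb`, engine dag-n06-j's levelled coverage bound) and `cP := 2·c335Plaq ℓ aInv`,
`hplaq := plaqLawY_of_reg335PlaqY ∘ hreg335P_extraYPb` (the L² plaquette law of a `G`-valued base from the class law).  DISPLAYED: `hι hG1 b M₂ hrepr hcR hcL`,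
`MInv aInv aW` (`hMInv haInv haW hMd hMr`), `hunitA` (Thm 3.1's input `Δ_a(U)` invertible on the class = Thm 3.11 at the record), `hb₁`, `mN hnbr`, the Lemma-2.1 datum
`(d261, h261)` at the frames' threshold (now stated at `C₀ := c335Plaq ℓ aInv`), the record's Thms 3.2 ∕ 3.3 `h32 h33`; `C38` free.
[cite: Balaban1985BackgroundPropagators, Thm 3.4 p.400, Sect. B pp.400–407, (3.35) p.396, p.404 (after (3.69)), Thm 3.11 p.416; Balaban1984PropagatorsII, Lemma 2.1 p.234, (2.51) p.232] -/
theorem sectBStepU_C37GY_unitary_extraYPb [Nonempty (Fin N)] [NormOneClass (Matrix (Fin N) (Fin N) ℂ)] [FiniteDimensional ℝ (Matrix (Fin N) (Fin N) ℂ)]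
    (hG : G ≤ B7Prop2Explicit.unitaryUnits (Matrix (Fin N) (Fin N) ℂ))
    (hι : ∀ (j : J) (s : BlkY (f j).toKIdx), β (f j).toKIdx.hN (f j).toKIdx.D (f j).toKIdx.hk (ιB j s) = s)
    (hG1 : ∀ u : (Matrix (Fin N) (Fin N) ℂ)ˣ, u ∈ G → ‖(u : Matrix (Fin N) (Fin N) ℂ)‖ ≤ 1)
    (M₂ : ℝ) (hM₂ : 0 ≤ M₂) (hrepr : ∀ (v : Matrix (Fin N) (Fin N) ℂ) (j : ι), |b.repr v j| ≤ M₂ * ‖v‖) (hcR : 0 < M₂ * ∑ j, ‖b j‖)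
    (hcL : 0 < Real.sqrt (Fintype.card ι) * M₂ * ∑ j, ‖b j‖)
    (MInv aInv aW : ℝ) (hMInv : 0 < MInv) (haInv : 0 < aInv) (haW : 0 < aW)
    (hunitA : ∀ j (α₀ : ℝ) (U : CfgY (Matrix (Fin N) (Fin N) ℂ) (f j).toKIdx), MInv ≤ (geo9Y (f j)).M → 0 < α₀ → (geo9Y (f j)).M * α₀ ≤ aInv →
      (bg9YC (Matrix (Fin N) (Fin N) ℂ) G (extraYPb (Matrix (Fin N) (Fin N) ℂ) G) (f j)).Reg335 c35 α₀ U →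
      IsUnit (deltaAY (f j).toKIdx (parSymY (f j).toKIdx) (parBY (f j).toKIdx) (GpY (f j).toKIdx (parSymY (f j).toKIdx)) U)) (hb₁ : 0 ≤ b₁)
    (hMd : 2 * ((d : ℝ) + 1) < MInv) (mN : ℕ) (hnbr : ∀ (j : J) (y' : IBondY (f j).toKIdx), (nbr (geo9Y (f j)) (2 * ((d : ℝ) + 1)) y').card ≤ mN)
    (hMr : rLB d ℓ + 1 < MInv)
    (d261 : ℝ → ℕ)
    (h261 : ∀ (j : J) (δ α : ℝ), 0 < δ → δ ≤ 1 → 9 / 5000 ≤ α → α < 1 →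
      (gFrame₅CodedOn (extraYPb (Matrix (Fin N) (Fin N) ℂ) G) f c35 G (fun j => parSymY (f j).toKIdx) (fun j => parBY (f j).toKIdx) b ιB
        (fun j => C37GY G (f j) (ιB j) (4 * ((d : ℝ) + 1) * Real.exp (3 * (((d : ℝ) + 1) / 2)))) C38 hι hG1 (fun j _ hU z w => parSymY_mem (f j).toKIdx hU z w)
        (fun j _ hU => isUnit_deltaPrimeAY_parSymY (f j).toKIdx hG hU) M₂ hM₂ hrepr hcR (4 * ((d : ℝ) + 1) * Real.exp (3 * (((d : ℝ) + 1) / 2)))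
        (by positivity) (fun j => hC37_of_C37GY G (f j) (ιB j) _) MInv aInv aW hMInv haInv haW (fun j _ hU => isUnit_XY_parSymY (f j).toKIdx hG hU)
        (fun _ U z w => parSymY_inv_symm U z w) hunitA (hparB_parBY f G) hb₁ (c335Plaq ℓ aInv)
        (c335Plaq_nonneg ℓ haInv.le) (hreg335P_extraYPb G f ιB hι hMd aInv c35) (fun j => hC37G_of_C37GY G (f j) (ιB j) _) (cVarGY d ℓ)
        (cVarGY_nonneg d ℓ) (fun j => hvarB_of_C37GY G (f j) (ιB j) _) hMd mN hnbr).M261 δ ≤ (geo9Y (f j)).M →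
      Ineq261 (d261 δ) (toB6 (geo9Y (f j)) 0 True) δ α)
    (h32 : B9.Thm32Printed (d + 1) c35 (fun j => geo9Y (f j)) (fun j => bg9YC (Matrix (Fin N) (Fin N) ℂ) G (extraYPb (Matrix (Fin N) (Fin N) ℂ) G) (f j)) (CinvY (extraYPb (Matrix (Fin N) (Fin N) ℂ) G) f G (fun j => parSymY (f j).toKIdx)))
    (h33 : B9.Thm33Printed c35 (fun j => geo9Y (f j)) (fun j => bg9YC (Matrix (Fin N) (Fin N) ℂ) G (extraYPb (Matrix (Fin N) (Fin N) ℂ) G) (f j))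
      (fun j => kernelFamilyS (f j).toKIdx (bg9YC (Matrix (Fin N) (Fin N) ℂ) G (extraYPb (Matrix (Fin N) (Fin N) ℂ) G) (f j)) (fun U => U) (GpY (f j).toKIdx (parSymY (f j).toKIdx))
        (parSymY (f j).toKIdx))
      (fun j => kernelFamilyB (f j).toKIdx (bg9YC (Matrix (Fin N) (Fin N) ℂ) G (extraYPb (Matrix (Fin N) (Fin N) ℂ) G) (f j)) (fun U => U)
        (GAY (f j).toKIdx (parSymY (f j).toKIdx) (parBY (f j).toKIdx) (GpY (f j).toKIdx (parSymY (f j).toKIdx))) (parBY (f j).toKIdx))) :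
    SectBStepU (extraYPb (Matrix (Fin N) (Fin N) ℂ) G) f (d + 1) c35 G b (fun j => parSymY (f j).toKIdx)
      (fun j => GAY (f j).toKIdx (parSymY (f j).toKIdx) (parBY (f j).toKIdx) (GpY (f j).toKIdx (parSymY (f j).toKIdx))) (fun j => parBY (f j).toKIdx)
      (fun j => C37GY G (f j) (ιB j) (4 * ((d : ℝ) + 1) * Real.exp (3 * (((d : ℝ) + 1) / 2)))) C38 (CinvY (extraYPb (Matrix (Fin N) (Fin N) ℂ) G) f G (fun j => parSymY (f j).toKIdx))  :=
  sectBStepU_C37GY_unitary_of_members_g (extraYPb (Matrix (Fin N) (Fin N) ℂ) G) f c35 G b ιB C38 hG hι hG1 M₂ hM₂ hrepr hcR hcL MInv aInv aW hMInv haInv haW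
    hunitA hb₁ (c335Plaq ℓ aInv) (c335Plaq_nonneg ℓ haInv.le) (hreg335P_extraYPb G f ιB hι hMd aInv c35) hMd mN hnbr hMr
    (cP := 2 * c335Plaq ℓ aInv) (mul_nonneg zero_le_two (c335Plaq_nonneg ℓ haInv.le))
    (fun j α₀ U hM hα hMa hU => plaqLawY_of_reg335PlaqY G (f j) (ιB j) hG1 hU.1.1 (c335Plaq_nonneg ℓ haInv.le)
      (hreg335P_extraYPb G f ιB hι hMd aInv c35 j α₀ U hM hα hMa hU))
    d261 h261 h32 h33

/-- ★★ **THEOREM 3.4 IN U-LETTERS AT THE RECORD's READING OF PRINT's CLASS** (`Thm34U … (C37GY) C38` at `P := extraYPb`, `𝔸 = M_N(ℂ)`, `N ≥ 1`, `G ≦ U(N)`):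
`B9.thm34_of_sectB` on `sectBStepU_C37GY_unitary_extraYPb` with the record's Thms 3.2 ∕ 3.3 read over the coded carrier (`thm32∕33Printed_codedU`) — dag-n06-d's
`thm34U_of_members`, verbatim at the instance. Same displayed inputs as `sectBStepU_C37GY_unitary_extraYPb`.
[cite: Balaban1985BackgroundPropagators, Thm 3.4 p.400, p.407 («Thus Theorem 3.4 is proved, assuming that Theorems 3.1–3.3 hold»)] -/
theorem thm34U_C37GY_unitary_extraYPb [Nonempty (Fin N)] [NormOneClass (Matrix (Fin N) (Fin N) ℂ)] [FiniteDimensional ℝ (Matrix (Fin N) (Fin N) ℂ)]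
    (hG : G ≤ B7Prop2Explicit.unitaryUnits (Matrix (Fin N) (Fin N) ℂ))
    (hι : ∀ (j : J) (s : BlkY (f j).toKIdx), β (f j).toKIdx.hN (f j).toKIdx.D (f j).toKIdx.hk (ιB j s) = s)
    (hG1 : ∀ u : (Matrix (Fin N) (Fin N) ℂ)ˣ, u ∈ G → ‖(u : Matrix (Fin N) (Fin N) ℂ)‖ ≤ 1)
    (M₂ : ℝ) (hM₂ : 0 ≤ M₂) (hrepr : ∀ (v : Matrix (Fin N) (Fin N) ℂ) (j : ι), |b.repr v j| ≤ M₂ * ‖v‖) (hcR : 0 < M₂ * ∑ j, ‖b j‖)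
    (hcL : 0 < Real.sqrt (Fintype.card ι) * M₂ * ∑ j, ‖b j‖)
    (MInv aInv aW : ℝ) (hMInv : 0 < MInv) (haInv : 0 < aInv) (haW : 0 < aW)
    (hunitA : ∀ j (α₀ : ℝ) (U : CfgY (Matrix (Fin N) (Fin N) ℂ) (f j).toKIdx), MInv ≤ (geo9Y (f j)).M → 0 < α₀ → (geo9Y (f j)).M * α₀ ≤ aInv →
      (bg9YC (Matrix (Fin N) (Fin N) ℂ) G (extraYPb (Matrix (Fin N) (Fin N) ℂ) G) (f j)).Reg335 c35 α₀ U →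
      IsUnit (deltaAY (f j).toKIdx (parSymY (f j).toKIdx) (parBY (f j).toKIdx) (GpY (f j).toKIdx (parSymY (f j).toKIdx)) U)) (hb₁ : 0 ≤ b₁)
    (hMd : 2 * ((d : ℝ) + 1) < MInv) (mN : ℕ) (hnbr : ∀ (j : J) (y' : IBondY (f j).toKIdx), (nbr (geo9Y (f j)) (2 * ((d : ℝ) + 1)) y').card ≤ mN)
    (hMr : rLB d ℓ + 1 < MInv)
    (d261 : ℝ → ℕ)
    (h261 : ∀ (j : J) (δ α : ℝ), 0 < δ → δ ≤ 1 → 9 / 5000 ≤ α → α < 1 →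
      (gFrame₅CodedOn (extraYPb (Matrix (Fin N) (Fin N) ℂ) G) f c35 G (fun j => parSymY (f j).toKIdx) (fun j => parBY (f j).toKIdx) b ιB
        (fun j => C37GY G (f j) (ιB j) (4 * ((d : ℝ) + 1) * Real.exp (3 * (((d : ℝ) + 1) / 2)))) C38 hι hG1 (fun j _ hU z w => parSymY_mem (f j).toKIdx hU z w)
        (fun j _ hU => isUnit_deltaPrimeAY_parSymY (f j).toKIdx hG hU) M₂ hM₂ hrepr hcR (4 * ((d : ℝ) + 1) * Real.exp (3 * (((d : ℝ) + 1) / 2)))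
        (by positivity) (fun j => hC37_of_C37GY G (f j) (ιB j) _) MInv aInv aW hMInv haInv haW (fun j _ hU => isUnit_XY_parSymY (f j).toKIdx hG hU)
        (fun _ U z w => parSymY_inv_symm U z w) hunitA (hparB_parBY f G) hb₁ (c335Plaq ℓ aInv)
        (c335Plaq_nonneg ℓ haInv.le) (hreg335P_extraYPb G f ιB hι hMd aInv c35) (fun j => hC37G_of_C37GY G (f j) (ιB j) _) (cVarGY d ℓ)
        (cVarGY_nonneg d ℓ) (fun j => hvarB_of_C37GY G (f j) (ιB j) _) hMd mN hnbr).M261 δ ≤ (geo9Y (f j)).M →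
      Ineq261 (d261 δ) (toB6 (geo9Y (f j)) 0 True) δ α)
    (h32 : B9.Thm32Printed (d + 1) c35 (fun j => geo9Y (f j)) (fun j => bg9YC (Matrix (Fin N) (Fin N) ℂ) G (extraYPb (Matrix (Fin N) (Fin N) ℂ) G) (f j)) (CinvY (extraYPb (Matrix (Fin N) (Fin N) ℂ) G) f G (fun j => parSymY (f j).toKIdx)))
    (h33 : B9.Thm33Printed c35 (fun j => geo9Y (f j)) (fun j => bg9YC (Matrix (Fin N) (Fin N) ℂ) G (extraYPb (Matrix (Fin N) (Fin N) ℂ) G) (f j))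
      (fun j => kernelFamilyS (f j).toKIdx (bg9YC (Matrix (Fin N) (Fin N) ℂ) G (extraYPb (Matrix (Fin N) (Fin N) ℂ) G) (f j)) (fun U => U) (GpY (f j).toKIdx (parSymY (f j).toKIdx))
        (parSymY (f j).toKIdx))
      (fun j => kernelFamilyB (f j).toKIdx (bg9YC (Matrix (Fin N) (Fin N) ℂ) G (extraYPb (Matrix (Fin N) (Fin N) ℂ) G) (f j)) (fun U => U)
        (GAY (f j).toKIdx (parSymY (f j).toKIdx) (parBY (f j).toKIdx) (GpY (f j).toKIdx (parSymY (f j).toKIdx))) (parBY (f j).toKIdx))) :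
    Thm34U (extraYPb (Matrix (Fin N) (Fin N) ℂ) G) f c35 G b (fun j => parSymY (f j).toKIdx)
      (fun j => GAY (f j).toKIdx (parSymY (f j).toKIdx) (parBY (f j).toKIdx) (GpY (f j).toKIdx (parSymY (f j).toKIdx))) (fun j => parBY (f j).toKIdx)
      (fun j => C37GY G (f j) (ιB j) (4 * ((d : ℝ) + 1) * Real.exp (3 * (((d : ℝ) + 1) / 2)))) C38 :=
  B9.thm34_of_sectB (d + 1) c35 (fun j => geo9Y (f j)) (fun j => (codingYx (extraYPb (Matrix (Fin N) (Fin N) ℂ) G) G (f j) ((fun j => C37GY G (f j) (ιB j) (4 * ((d : ℝ) + 1) * Real.exp (3 * (((d : ℝ) + 1) / 2)))) j) (C38 j)).bg)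
    (fun j => KSCU (extraYPb (Matrix (Fin N) (Fin N) ℂ) G) G (f j) (parSymY (f j).toKIdx) ((fun j => C37GY G (f j) (ιB j) (4 * ((d : ℝ) + 1) * Real.exp (3 * (((d : ℝ) + 1) / 2)))) j) (C38 j))
    (fun j => KACU (extraYPb (Matrix (Fin N) (Fin N) ℂ) G) G (f j) (GAY (f j).toKIdx (parSymY (f j).toKIdx) (parBY (f j).toKIdx) (GpY (f j).toKIdx (parSymY (f j).toKIdx))) (parBY (f j).toKIdx)
      ((fun j => C37GY G (f j) (ιB j) (4 * ((d : ℝ) + 1) * Real.exp (3 * (((d : ℝ) + 1) / 2)))) j) (C38 j))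
    (fun j => pullS (codingYx (extraYPb (Matrix (Fin N) (Fin N) ℂ) G) G (f j) ((fun j => C37GY G (f j) (ιB j) (4 * ((d : ℝ) + 1) * Real.exp (3 * (((d : ℝ) + 1) / 2)))) j) (C38 j)) (CinvY (extraYPb (Matrix (Fin N) (Fin N) ℂ) G) f G (fun j => parSymY (f j).toKIdx) j))
    (fun j => IsAnKY (extraYPb (Matrix (Fin N) (Fin N) ℂ) G) G (f j) (parSymY (f j).toKIdx) b ((fun j => C37GY G (f j) (ιB j) (4 * ((d : ℝ) + 1) * Real.exp (3 * (((d : ℝ) + 1) / 2)))) j) (C38 j))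
    (sectBStepU_C37GY_unitary_extraYPb f c35 G b ιB C38 hG hι hG1 M₂ hM₂ hrepr hcR hcL MInv aInv aW hMInv haInv haW hunitA hb₁ hMd mN hnbr hMr d261 h261 h32 h33)
    (thm32Printed_codedU (extraYPb (Matrix (Fin N) (Fin N) ℂ) G) f c35 G C38 (fun j => C37GY G (f j) (ιB j) (4 * ((d : ℝ) + 1) * Real.exp (3 * (((d : ℝ) + 1) / 2)))) _ (d + 1) h32)
    (thm33Printed_codedU (extraYPb (Matrix (Fin N) (Fin N) ℂ) G) f c35 G C38 (fun j => parSymY (f j).toKIdx) _ (fun j => parBY (f j).toKIdx) (fun j => C37GY G (f j) (ιB j) (4 * ((d : ℝ) + 1) * Real.exp (3 * (((d : ℝ) + 1) / 2)))) h33)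

/-- ★★★ **… WITH THE LEMMA-2.1 DATUM DISCHARGED TOO**: §4's theorem at `d261 := B9SectBL2GFrameCodedY.d261Y`, `h261 := d261Y_spec` (dag-n06-c gen 14's [4] Lemma 2.1
(2.61) supplier above the frames' threshold `M261 = M261Y` — definitional).  DISPLAYED: `hι hG1 b M₂ hrepr hcR hcL`, `MInv aInv aW` (+ `hMInv haInv haW hMd hMr`), the
GUARDED `hunitA` (Thm 3.11), `hb₁`, `mN hnbr`, the record's Thms 3.2 ∕ 3.3 `h32 h33`; `C38` free.
[cite: Balaban1985BackgroundPropagators, Thm 3.4 p.400, Sect. B pp.400–407, Thm 3.11 p.416; Balaban1984PropagatorsII, Lemma 2.1 (2.59)–(2.61) pp.233–234] -/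
theorem sectBStepU_C37GY_unitary_extraYPb_d261Y [Nonempty (Fin N)] [NormOneClass (Matrix (Fin N) (Fin N) ℂ)] [FiniteDimensional ℝ (Matrix (Fin N) (Fin N) ℂ)]
    (hG : G ≤ B7Prop2Explicit.unitaryUnits (Matrix (Fin N) (Fin N) ℂ))
    (hι : ∀ (j : J) (s : BlkY (f j).toKIdx), β (f j).toKIdx.hN (f j).toKIdx.D (f j).toKIdx.hk (ιB j s) = s)
    (hG1 : ∀ u : (Matrix (Fin N) (Fin N) ℂ)ˣ, u ∈ G → ‖(u : Matrix (Fin N) (Fin N) ℂ)‖ ≤ 1)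
    (M₂ : ℝ) (hM₂ : 0 ≤ M₂) (hrepr : ∀ (v : Matrix (Fin N) (Fin N) ℂ) (j : ι), |b.repr v j| ≤ M₂ * ‖v‖) (hcR : 0 < M₂ * ∑ j, ‖b j‖)
    (hcL : 0 < Real.sqrt (Fintype.card ι) * M₂ * ∑ j, ‖b j‖)
    (MInv aInv aW : ℝ) (hMInv : 0 < MInv) (haInv : 0 < aInv) (haW : 0 < aW)
    (hunitA : ∀ j (α₀ : ℝ) (U : CfgY (Matrix (Fin N) (Fin N) ℂ) (f j).toKIdx), MInv ≤ (geo9Y (f j)).M → 0 < α₀ → (geo9Y (f j)).M * α₀ ≤ aInv →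
      (bg9YC (Matrix (Fin N) (Fin N) ℂ) G (extraYPb (Matrix (Fin N) (Fin N) ℂ) G) (f j)).Reg335 c35 α₀ U →
      IsUnit (deltaAY (f j).toKIdx (parSymY (f j).toKIdx) (parBY (f j).toKIdx) (GpY (f j).toKIdx (parSymY (f j).toKIdx)) U)) (hb₁ : 0 ≤ b₁)
    (hMd : 2 * ((d : ℝ) + 1) < MInv) (mN : ℕ) (hnbr : ∀ (j : J) (y' : IBondY (f j).toKIdx), (nbr (geo9Y (f j)) (2 * ((d : ℝ) + 1)) y').card ≤ mN)
    (hMr : rLB d ℓ + 1 < MInv)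
    (h32 : B9.Thm32Printed (d + 1) c35 (fun j => geo9Y (f j)) (fun j => bg9YC (Matrix (Fin N) (Fin N) ℂ) G (extraYPb (Matrix (Fin N) (Fin N) ℂ) G) (f j)) (CinvY (extraYPb (Matrix (Fin N) (Fin N) ℂ) G) f G (fun j => parSymY (f j).toKIdx)))
    (h33 : B9.Thm33Printed c35 (fun j => geo9Y (f j)) (fun j => bg9YC (Matrix (Fin N) (Fin N) ℂ) G (extraYPb (Matrix (Fin N) (Fin N) ℂ) G) (f j))
      (fun j => kernelFamilyS (f j).toKIdx (bg9YC (Matrix (Fin N) (Fin N) ℂ) G (extraYPb (Matrix (Fin N) (Fin N) ℂ) G) (f j)) (fun U => U) (GpY (f j).toKIdx (parSymY (f j).toKIdx))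
        (parSymY (f j).toKIdx))
      (fun j => kernelFamilyB (f j).toKIdx (bg9YC (Matrix (Fin N) (Fin N) ℂ) G (extraYPb (Matrix (Fin N) (Fin N) ℂ) G) (f j)) (fun U => U)
        (GAY (f j).toKIdx (parSymY (f j).toKIdx) (parBY (f j).toKIdx) (GpY (f j).toKIdx (parSymY (f j).toKIdx))) (parBY (f j).toKIdx))) :
    SectBStepU (extraYPb (Matrix (Fin N) (Fin N) ℂ) G) f (d + 1) c35 G b (fun j => parSymY (f j).toKIdx)
      (fun j => GAY (f j).toKIdx (parSymY (f j).toKIdx) (parBY (f j).toKIdx) (GpY (f j).toKIdx (parSymY (f j).toKIdx))) (fun j => parBY (f j).toKIdx)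
      (fun j => C37GY G (f j) (ιB j) (4 * ((d : ℝ) + 1) * Real.exp (3 * (((d : ℝ) + 1) / 2)))) C38 (CinvY (extraYPb (Matrix (Fin N) (Fin N) ℂ) G) f G (fun j => parSymY (f j).toKIdx))  :=
  sectBStepU_C37GY_unitary_extraYPb f c35 G b ιB C38 hG hι hG1 M₂ hM₂ hrepr hcR hcL MInv aInv aW hMInv haInv haW hunitA hb₁ hMd mN hnbr hMr
    B9SectBL2GFrameCodedY.d261Y (fun j _ _ hδ _ hα hα1 hM => B9SectBL2GFrameCodedY.d261Y_spec (f j) hδ hα hα1.le hM) h32 h33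

/-- ★★ Theorem 3.4 in U-letters at the record's reading of print's class, Lemma-2.1 datum discharged (over `sectBStepU_C37GY_unitary_extraYPb_d261Y`).
[cite: Balaban1985BackgroundPropagators, Thm 3.4 p.400; Balaban1984PropagatorsII, Lemma 2.1 p.234] -/
theorem thm34U_C37GY_unitary_extraYPb_d261Y [Nonempty (Fin N)] [NormOneClass (Matrix (Fin N) (Fin N) ℂ)] [FiniteDimensional ℝ (Matrix (Fin N) (Fin N) ℂ)]
    (hG : G ≤ B7Prop2Explicit.unitaryUnits (Matrix (Fin N) (Fin N) ℂ))
    (hι : ∀ (j : J) (s : BlkY (f j).toKIdx), β (f j).toKIdx.hN (f j).toKIdx.D (f j).toKIdx.hk (ιB j s) = s)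
    (hG1 : ∀ u : (Matrix (Fin N) (Fin N) ℂ)ˣ, u ∈ G → ‖(u : Matrix (Fin N) (Fin N) ℂ)‖ ≤ 1)
    (M₂ : ℝ) (hM₂ : 0 ≤ M₂) (hrepr : ∀ (v : Matrix (Fin N) (Fin N) ℂ) (j : ι), |b.repr v j| ≤ M₂ * ‖v‖) (hcR : 0 < M₂ * ∑ j, ‖b j‖)
    (hcL : 0 < Real.sqrt (Fintype.card ι) * M₂ * ∑ j, ‖b j‖)
    (MInv aInv aW : ℝ) (hMInv : 0 < MInv) (haInv : 0 < aInv) (haW : 0 < aW)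
    (hunitA : ∀ j (α₀ : ℝ) (U : CfgY (Matrix (Fin N) (Fin N) ℂ) (f j).toKIdx), MInv ≤ (geo9Y (f j)).M → 0 < α₀ → (geo9Y (f j)).M * α₀ ≤ aInv →
      (bg9YC (Matrix (Fin N) (Fin N) ℂ) G (extraYPb (Matrix (Fin N) (Fin N) ℂ) G) (f j)).Reg335 c35 α₀ U →
      IsUnit (deltaAY (f j).toKIdx (parSymY (f j).toKIdx) (parBY (f j).toKIdx) (GpY (f j).toKIdx (parSymY (f j).toKIdx)) U)) (hb₁ : 0 ≤ b₁)
    (hMd : 2 * ((d : ℝ) + 1) < MInv) (mN : ℕ) (hnbr : ∀ (j : J) (y' : IBondY (f j).toKIdx), (nbr (geo9Y (f j)) (2 * ((d : ℝ) + 1)) y').card ≤ mN)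
    (hMr : rLB d ℓ + 1 < MInv)
    (h32 : B9.Thm32Printed (d + 1) c35 (fun j => geo9Y (f j)) (fun j => bg9YC (Matrix (Fin N) (Fin N) ℂ) G (extraYPb (Matrix (Fin N) (Fin N) ℂ) G) (f j)) (CinvY (extraYPb (Matrix (Fin N) (Fin N) ℂ) G) f G (fun j => parSymY (f j).toKIdx)))
    (h33 : B9.Thm33Printed c35 (fun j => geo9Y (f j)) (fun j => bg9YC (Matrix (Fin N) (Fin N) ℂ) G (extraYPb (Matrix (Fin N) (Fin N) ℂ) G) (f j))
      (fun j => kernelFamilyS (f j).toKIdx (bg9YC (Matrix (Fin N) (Fin N) ℂ) G (extraYPb (Matrix (Fin N) (Fin N) ℂ) G) (f j)) (fun U => U) (GpY (f j).toKIdx (parSymY (f j).toKIdx))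
        (parSymY (f j).toKIdx))
      (fun j => kernelFamilyB (f j).toKIdx (bg9YC (Matrix (Fin N) (Fin N) ℂ) G (extraYPb (Matrix (Fin N) (Fin N) ℂ) G) (f j)) (fun U => U)
        (GAY (f j).toKIdx (parSymY (f j).toKIdx) (parBY (f j).toKIdx) (GpY (f j).toKIdx (parSymY (f j).toKIdx))) (parBY (f j).toKIdx))) :
    Thm34U (extraYPb (Matrix (Fin N) (Fin N) ℂ) G) f c35 G b (fun j => parSymY (f j).toKIdx)
      (fun j => GAY (f j).toKIdx (parSymY (f j).toKIdx) (parBY (f j).toKIdx) (GpY (f j).toKIdx (parSymY (f j).toKIdx))) (fun j => parBY (f j).toKIdx)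
      (fun j => C37GY G (f j) (ιB j) (4 * ((d : ℝ) + 1) * Real.exp (3 * (((d : ℝ) + 1) / 2)))) C38 :=
  B9.thm34_of_sectB (d + 1) c35 (fun j => geo9Y (f j)) (fun j => (codingYx (extraYPb (Matrix (Fin N) (Fin N) ℂ) G) G (f j) ((fun j => C37GY G (f j) (ιB j) (4 * ((d : ℝ) + 1) * Real.exp (3 * (((d : ℝ) + 1) / 2)))) j) (C38 j)).bg)
    (fun j => KSCU (extraYPb (Matrix (Fin N) (Fin N) ℂ) G) G (f j) (parSymY (f j).toKIdx) ((fun j => C37GY G (f j) (ιB j) (4 * ((d : ℝ) + 1) * Real.exp (3 * (((d : ℝ) + 1) / 2)))) j) (C38 j))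
    (fun j => KACU (extraYPb (Matrix (Fin N) (Fin N) ℂ) G) G (f j) (GAY (f j).toKIdx (parSymY (f j).toKIdx) (parBY (f j).toKIdx) (GpY (f j).toKIdx (parSymY (f j).toKIdx))) (parBY (f j).toKIdx)
      ((fun j => C37GY G (f j) (ιB j) (4 * ((d : ℝ) + 1) * Real.exp (3 * (((d : ℝ) + 1) / 2)))) j) (C38 j))
    (fun j => pullS (codingYx (extraYPb (Matrix (Fin N) (Fin N) ℂ) G) G (f j) ((fun j => C37GY G (f j) (ιB j) (4 * ((d : ℝ) + 1) * Real.exp (3 * (((d : ℝ) + 1) / 2)))) j) (C38 j)) (CinvY (extraYPb (Matrix (Fin N) (Fin N) ℂ) G) f G (fun j => parSymY (f j).toKIdx) j))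
    (fun j => IsAnKY (extraYPb (Matrix (Fin N) (Fin N) ℂ) G) G (f j) (parSymY (f j).toKIdx) b ((fun j => C37GY G (f j) (ιB j) (4 * ((d : ℝ) + 1) * Real.exp (3 * (((d : ℝ) + 1) / 2)))) j) (C38 j))
    (sectBStepU_C37GY_unitary_extraYPb_d261Y f c35 G b ιB C38 hG hι hG1 M₂ hM₂ hrepr hcR hcL MInv aInv aW hMInv haInv haW hunitA hb₁ hMd mN hnbr hMr h32 h33)
    (thm32Printed_codedU (extraYPb (Matrix (Fin N) (Fin N) ℂ) G) f c35 G C38 (fun j => C37GY G (f j) (ιB j) (4 * ((d : ℝ) + 1) * Real.exp (3 * (((d : ℝ) + 1) / 2)))) _ (d + 1) h32)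
    (thm33Printed_codedU (extraYPb (Matrix (Fin N) (Fin N) ℂ) G) f c35 G C38 (fun j => parSymY (f j).toKIdx) _ (fun j => parBY (f j).toKIdx) (fun j => C37GY G (f j) (ιB j) (4 * ((d : ℝ) + 1) * Real.exp (3 * (((d : ℝ) + 1) / 2)))) h33)

end ClassPb

end Members

end Literature.MathematicalPhysics.QuantumFieldTheory.Balaban1983to89.B9SectBStepUGuardedR

end
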